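import Literature.Barriers.CriticalPhenomena.PlaquetteWalkDominoRigidity
import HarnessLib

/-!
# Barrier catalogue (SAWScalingLimit): SHARPER generic triviality of the domino technique class —
two more block instances cut the exceptional hypersurface down further (three determinants per branch)

Companion of `PlaquetteWalkDominoRigidity`: there a nonzero two-plaquette identity with `u₁u₂ ≠ 0` was
located on `{dominoDetA = 0} ∪ {dominoDetS = 0}`. Here two more instances of the `2 × 2` block — from the
SOUTH side of the lower-left plaquette `(0,0)` and from the SOUTH side of the lower-right plaquette `(1,0)` —
and their half-turn images (north sides of `(1,0)` / `(0,0)` in the block below) are typed (4 + 4 `decide`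
instances of the certified enumerator). They give the antisymmetric determinants `dominoDetA2` (14 terms,
linear in `w₁`) and `dominoDetA3` (14 terms, linear in `w₂`) and the symmetric determinants `dominoDetS2`,
`dominoDetS3` (23 terms each; `w₁` resp. `w₂` enter through the walk doubling a corner resp. a co-corner
plaquette of the block). ★★ `eq_zero_of_exactDominoVertexRelation_sharp`: for `u₁u₂ ≠ 0`, `t ≠ 0`, if ONE
of `dominoDetA, dominoDetA2, dominoDetA3` and ONE of `dominoDetS, dominoDetS2, dominoDetS3` is nonzero, every
exact domino relation is trivial; equivalently (★★ `PlaquetteWalkDominoGenericTrivialitySharp_holds`) a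
nonzero identity lies on `{dominoDetA = dominoDetA2 = dominoDetA3 = 0} ∪ {dominoDetS = dominoDetS2 = dominoDetS3 = 0}`
— an explicit algebraic set; it has codimension TWO: it contains the four families `{v = ±1, u₂ = ±t²u₁}`
(A-branch) / `{v = ±1, u₁ = ±t²u₂}` (S-branch) with `w₁, w₂` free and one further family per branch over
`Q(u₁,v,t) = (1+t⁴)²u₁²(u₁²−v²−1) + 4t⁴v² = 0` (lane exact algebra, lit-2 g21, `pub-sawmu-lit-2/g21/cells/domY3/`)
— as well as Glazman's degenerate family. Also typed: the factorisation ★ `dominoDetA = −P₋·P₊`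
(`dominoDetA_eq_neg_mul`). Uniform SAW specialisations: `dominoDetA2_saw`, `dominoDetS2_saw`.

Sources: [cite: GlazmanManolescu2019, §1 Fig. 1,
    eq. (1); Lemma 2.1 (statement, "in the form given in [Gl]")];
[cite: Glazman2015WeightedSAW, Lemma 3.1 (proof: grouping of the walks at a rhombus; "solving this linear system")]; [cite: IkhlefCardy2009, §3
(determinant of the local linear system)]; [cite: DuminilCopinSmirnov2012,
    Lemma 1]. Status in print: as for
`PlaquetteWalkDominoRigidity` — the determinant device is printed for one plaquette; the two-plaquette
determinants are the venture lane's («pcv-sawmu», Tier B SEARCH 1,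
    b-engine-1 gen 14) — NEW-IN-WRITING
(modest; label lit-2 g20/g21). Not claimed: that the exceptional set carries identities off the known families;
whether the codimension-two families above carry nonzero domino identities is OPEN (lane question).
Implementation: `rowLW_mul` … `rowRS_mul`, `instBlockW`, `instBlockE` are private in
`PlaquetteWalkDominoRigidity` and `vertexFunctional_mul_pow_eq_rowSumN` in `PlaquetteWalkSpinRigidity`; read
via `open private … from`.
-/

noncomputable section

open Complex

namespace Literature.Barriers.CriticalPhenomena

open Literature.Probability.RandomPlanarGeometry.SAW.YangBaxter

namespace PlaquetteWalk

open private vertexFunctional_mul_pow_eq_rowSumN from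
  Literature.Barriers.CriticalPhenomena.PlaquetteWalkSpinRigidity
open private rowLW_mul rowLN_mul rowLS_mul rowRE_mul rowRN_mul rowRS_mul instBlockW instBlockE from
  Literature.Barriers.CriticalPhenomena.PlaquetteWalkDominoRigidity

section Sharp

variable {W : CWeights} {t : ℂ} {c : Fin 7 → ℂ}

/-- ★ **The second antisymmetric domino determinant** (rows `W`, `S` of the cleared antisymmetric system and
the antisymmetrised block-`S` instance, divided by `u₁²u₂t³`): 14 terms, linear in `w₁`.
[cite: Glazman2015WeightedSAW, Lemma 3.1 (proof: the determinant of the local linear system)] -/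
def dominoDetA2 (W : CWeights) (t : ℂ) : ℂ :=
  W.u₂ * W.v - 2 * W.u₂ * W.v * W.w₁ * t ^ 4 + W.u₂ * W.v ^ 3 - (W.u₂ ^ 3 * W.v)
      - (W.u₁ * t ^ 6) + W.u₁ * W.w₁ * t ^ 6 - 2 * W.u₁ * W.v ^ 2 * t ^ 2
      + W.u₁ * W.v ^ 2 * t ^ 6 + W.u₁ * W.v ^ 2 * W.w₁ * t ^ 6 + W.u₁ * W.u₂ ^ 2 * t ^ 6
      + W.u₁ * W.u₂ ^ 2 * W.w₁ * t ^ 2 - (W.u₁ ^ 2 * W.u₂ * W.v * t ^ 8) + W.u₁ ^ 3 * t ^ 6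
      - (W.u₁ ^ 3 * W.w₁ * t ^ 6)

/-- ★ **The second symmetric domino determinant** (the three symmetrised cleared rows and the symmetrised
block-`S` instance, divided by `2u₁²u₂t²`): 23 terms. [cite: Glazman2015WeightedSAW, Lemma 3.1 (proof: the determinant of the local linear system)] -/
def dominoDetS2 (W : CWeights) (t : ℂ) : ℂ :=
  -(W.v * W.w₁ * t ^ 8) + W.v ^ 3 * t ^ 4 + W.v ^ 3 * W.w₁ * t ^ 8 - (W.v ^ 5 * t ^ 4)
      + W.u₂ ^ 2 * W.v * t ^ 4 - (W.u₂ ^ 2 * W.v * W.w₁ * t ^ 8)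
      + 2 * W.u₂ ^ 2 * W.v ^ 3 * t ^ 4 - (W.u₂ ^ 4 * W.v * t ^ 4) - (W.u₁ * W.u₂ * t ^ 10)
      + W.u₁ * W.u₂ * W.w₁ * t ^ 6 + W.u₁ * W.u₂ * W.w₁ * t ^ 10
      - 3 * W.u₁ * W.u₂ * W.v ^ 2 * t ^ 2 - 3 * W.u₁ * W.u₂ * W.v ^ 2 * t ^ 6
      - (W.u₁ * W.u₂ * W.v ^ 2 * t ^ 10) + W.u₁ * W.u₂ ^ 3 * t ^ 10 + W.u₁ ^ 2 * W.v * t ^ 4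
      + 2 * W.u₁ ^ 2 * W.v * t ^ 8 - (W.u₁ ^ 2 * W.v * W.w₁ * t ^ 8)
      + 2 * W.u₁ ^ 2 * W.v ^ 3 * t ^ 4 + W.u₁ ^ 2 * W.u₂ ^ 2 * W.v
      + W.u₁ ^ 2 * W.u₂ ^ 2 * W.v * t ^ 8 - (W.u₁ ^ 3 * W.u₂ * t ^ 6) - (W.u₁ ^ 4 * W.v * t ^ 4)

/-- `dominoDetA2` of the uniform self-avoiding walk `(x, x, x, 0, 0)`. [cite: GlazmanManolescu2019, §1 (the uniform walk as a point of the family)] -/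
theorem dominoDetA2_saw (x t : ℂ) : dominoDetA2 ⟨x, x, x, 0, 0⟩ t = -(x * t ^ 6) + x ^ 2
    - 2 * x ^ 3 * t ^ 2 + 3 * x ^ 3 * t ^ 6 - (x ^ 4 * t ^ 8) := by
  rw [dominoDetA2]; ring

/-- `dominoDetS2` of the uniform self-avoiding walk `(x, x, x, 0, 0)`. [cite: GlazmanManolescu2019, §1 (the uniform walk as a point of the family)] -/
theorem dominoDetS2_saw (x t : ℂ) : dominoDetS2 ⟨x, x, x, 0, 0⟩ t = -(x ^ 2 * t ^ 10)
    + 3 * x ^ 3 * t ^ 4 + 2 * x ^ 3 * t ^ 8 - 3 * x ^ 4 * t ^ 2 - 4 * x ^ 4 * t ^ 6 + x ^ 5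
    + x ^ 5 * t ^ 4 + x ^ 5 * t ^ 8 := by
  rw [dominoDetS2]; ring

/-- ★ **The third antisymmetric domino determinant** (rows `W`, `N` of the cleared antisymmetric system and
the antisymmetrised block instance from the south side of `(1,0)`, divided by `u₁u₂²t³`): 14 terms, linear in
`w₂` — the `u₁ ↔ u₂`, `w₁ ↔ w₂`, `t ↦ t⁻¹` mirror of `dominoDetA2`. [cite: Glazman2015WeightedSAW, Lemma 3.1 (proof: the determinant of the local linear system)] -/
def dominoDetA3 (W : CWeights) (t : ℂ) : ℂ :=
  -(W.u₂ * t ^ 2) + W.u₂ * W.w₂ * t ^ 2 + W.u₂ * W.v ^ 2 * t ^ 2 - 2 * W.u₂ * W.v ^ 2 * t ^ 6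
      + W.u₂ * W.v ^ 2 * W.w₂ * t ^ 2 + W.u₂ ^ 3 * t ^ 2 - (W.u₂ ^ 3 * W.w₂ * t ^ 2)
      + W.u₁ * W.v * t ^ 8 - 2 * W.u₁ * W.v * W.w₂ * t ^ 4 + W.u₁ * W.v ^ 3 * t ^ 8
      - (W.u₁ * W.u₂ ^ 2 * W.v) + W.u₁ ^ 2 * W.u₂ * t ^ 2 + W.u₁ ^ 2 * W.u₂ * W.w₂ * t ^ 6
      - (W.u₁ ^ 3 * W.v * t ^ 8)

/-- ★ **The third symmetric domino determinant** (three symmetrised cleared rows and the symmetrised block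
instance from the south side of `(1,0)`, divided by `2u₁u₂²t⁶`): 23 terms, involves `w₂`. [cite: Glazman2015WeightedSAW, Lemma 3.1 (proof: the determinant of the local linear system)] -/
def dominoDetS3 (W : CWeights) (t : ℂ) : ℂ :=
  -(W.v * W.w₂ * t ^ 2) + W.v ^ 3 * t ^ 6 + W.v ^ 3 * W.w₂ * t ^ 2 - (W.v ^ 5 * t ^ 6)
      + 2 * W.u₂ ^ 2 * W.v * t ^ 2 + W.u₂ ^ 2 * W.v * t ^ 6 - (W.u₂ ^ 2 * W.v * W.w₂ * t ^ 2)
      + 2 * W.u₂ ^ 2 * W.v ^ 3 * t ^ 6 - (W.u₂ ^ 4 * W.v * t ^ 6) - (W.u₁ * W.u₂)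
      + W.u₁ * W.u₂ * W.w₂ + W.u₁ * W.u₂ * W.w₂ * t ^ 4 - (W.u₁ * W.u₂ * W.v ^ 2)
      - 3 * W.u₁ * W.u₂ * W.v ^ 2 * t ^ 4 - 3 * W.u₁ * W.u₂ * W.v ^ 2 * t ^ 8
      - (W.u₁ * W.u₂ ^ 3 * t ^ 4) + W.u₁ ^ 2 * W.v * t ^ 6 - (W.u₁ ^ 2 * W.v * W.w₂ * t ^ 2)
      + 2 * W.u₁ ^ 2 * W.v ^ 3 * t ^ 6 + W.u₁ ^ 2 * W.u₂ ^ 2 * W.v * t ^ 2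
      + W.u₁ ^ 2 * W.u₂ ^ 2 * W.v * t ^ 10 + W.u₁ ^ 3 * W.u₂ - (W.u₁ ^ 4 * W.v * t ^ 6)

/-- ★ `dominoDetA` FACTORS: `dominoDetA = −P₋·P₊` with `P∓ = u₁u₂(1 + t⁴) ∓ t²(u₁² + u₂² − (1 ∓ v)²)` — the
antisymmetric hypersurface is the union of two explicit ones (found by the lane's literature seat with exact
algebra; checked here by `ring`). [cite: Glazman2015WeightedSAW, Lemma 3.1 (proof: the determinant of the local linear system)] -/
theorem dominoDetA_eq_neg_mul (W : CWeights) (t : ℂ) :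
    dominoDetA W t = -((W.u₁ * W.u₂ * (1 + t ^ 4) - t ^ 2 * (W.u₁ ^ 2 + W.u₂ ^ 2 - (1 - W.v) ^ 2)) *
      (W.u₁ * W.u₂ * (1 + t ^ 4) + t ^ 2 * (W.u₁ ^ 2 + W.u₂ ^ 2 - (1 + W.v) ^ 2))) := by
  rw [dominoDetA]; ring

/-- The relation on the upper block, split (as in `PlaquetteWalkDominoRigidity`). [cite: DuminilCopinSmirnov2012, Lemma 1 (linear in the coefficients)] -/
private theorem split_blkD_S (hrel : ExactDominoVertexRelation W t c) {a : MidEdge}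
    (ha : IsBoundaryRoot blkD a) :
    vertexFunctional W t (leftCoeff c (c 3)) blkD a (0, 0) +
      vertexFunctional W t (rightCoeff c 0) blkD a (1, 0) = 0 := by
  have h := hrel blkD a (0, 0) (by simp [blkD]) (by simp [blkD, east]) ha
  rwa [dominoFunctional_eq_add W t c blkD a (0, 0) (show c 3 + 0 = c 3 by ring)] at h

/-- The relation on the lower block, split. [cite: DuminilCopinSmirnov2012, Lemma 1 (linear in the coefficients)] -/
private theorem split_blkD'_N (hrel : ExactDominoVertexRelation W t c) {a : MidEdge}
    (ha : IsBoundaryRoot blkD' a) :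
    vertexFunctional W t (leftCoeff c (c 3)) blkD' a (0, 0) +
      vertexFunctional W t (rightCoeff c 0) blkD' a (1, 0) = 0 := by
  have h := hrel blkD' a (0, 0) (by simp [blkD']) (by simp [blkD', east]) ha
  rwa [dominoFunctional_eq_add W t c blkD' a (0, 0) (show c 3 + 0 = c 3 by ring)] at h

/-- ★ Instance on the upper `2 × 2` block from the SOUTH side of `(0,0)` (7 + 8 walks, cleared by `t³`).
[cite: GlazmanManolescu2019, Lemma 2.1 (statement, "in the form given in [Gl]")] [cite: Glazman2015WeightedSAW, Lemma 3.1 (proof: the walks at one rhombus)] -/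
private theorem instBlockS (hrel : ExactDominoVertexRelation W t c) (ht : t ≠ 0) :
    c 2 * t ^ 3 + c 0 * W.u₂ * t ^ 4 + c 3 * W.u₁ * t ^ 2 + c 1 * W.u₁ ^ 3 * W.u₂ * t ^ 5
        + c 0 * W.u₁ ^ 2 * W.u₂ * W.w₁ * t ^ 4 + c 1 * W.v * t ^ 3
        + c 3 * W.u₁ ^ 2 * W.u₂ * W.v + c 6 * W.u₁ * W.v * t ^ 2 + c 5 * W.u₁ * W.u₂ * t
        + c 4 * W.u₁ ^ 2 * t ^ 3 + c 4 * W.u₁ * W.u₂ * W.v * t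
        + c 6 * W.u₁ * W.u₂ ^ 2 * W.v * t ^ 2 + c 5 * W.u₁ * W.u₂ * W.v ^ 2 * t = 0 := by
  have hT1 : termsN blkD (Face.side (0, 0) .S) (0, 0) (depth blkD) 3 =
      [⟨3, 0, 0, 0, 0, 0, 3⟩, ⟨2, 0, 1, 0, 0, 0, 4⟩, ⟨0, 1, 0, 0, 0, 0, 2⟩, ⟨1, 3, 1, 0, 0, 0,
          5⟩, ⟨2, 2, 1, 0, 1, 0, 4⟩, ⟨1, 0, 0, 1, 0, 0, 3⟩, ⟨0, 2, 1, 1, 0, 0, 0⟩] := by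
    decide
  have hT2 : termsN blkD (Face.side (0, 0) .S) (1, 0) (depth blkD) 3 =
      [⟨2, 1, 0, 0, 0, 0, 2⟩, ⟨0, 1, 0, 1, 0, 0, 2⟩, ⟨3, 1, 1, 0, 0, 0, 1⟩, ⟨1, 2, 0, 0, 0, 0,
          3⟩, ⟨1, 1, 1, 1, 0, 0, 1⟩, ⟨2, 2, 1, 1, 0, 0, 0⟩, ⟨0, 1, 2, 1, 0, 0, 2⟩, ⟨3, 1, 1, 2,
          0, 0, 1⟩] := by
    decide
  have h1 := vertexFunctional_mul_pow_eq_rowSumN W ht (leftCoeff c (c 3)) blkD (Face.side (0,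
      0) .S) (0, 0) 3
    (by decide)
  have h2 := vertexFunctional_mul_pow_eq_rowSumN W ht (rightCoeff c 0) blkD (Face.side (0,
      0) .S) (1, 0) 3
    (by decide)
  have h := split_blkD_S hrel (a := Face.side (0, 0) .S) (by decide)
  have h' : vertexFunctional W t (leftCoeff c (c 3)) blkD (Face.side (0, 0) .S) (0, 0) * t ^ 3 +
      vertexFunctional W t (rightCoeff c 0) blkD (Face.side (0, 0) .S) (1, 0) * t ^ 3 = 0 := by
    rw [← add_mul, h, zero_mul]
  rw [h1, h2, hT1, hT2] at h'
  simp only [rowSumN, List.map_cons, List.map_nil, List.sum_cons, List.sum_nil, CWeights.mono,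
      pow_zero,
    pow_one, mul_one, one_mul, leftCoeff, rightCoeff, Matrix.cons_val_zero, Matrix.cons_val_one,
    Matrix.head_cons, Matrix.cons_val_two, Matrix.tail_cons, Matrix.cons_val_three, zero_mul,
    add_zero] at h'
  linear_combination h'

/-- ★ The half-turn image: instance on the lower block from the NORTH side of `(1,0)`.
[cite: GlazmanManolescu2019, Lemma 2.1 (statement, "in the form given in [Gl]")] [cite: Glazman2015WeightedSAW, Lemma 3.1 (proof: the walks at one rhombus)] -/
private theorem instBlockN (hrel : ExactDominoVertexRelation W t c) (ht : t ≠ 0) :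
    c 3 * W.u₁ * t ^ 2 + c 0 * W.u₁ * W.v * t ^ 2 + c 1 * W.u₁ * W.u₂ * t
        + c 2 * W.u₁ ^ 2 * t ^ 3 + c 2 * W.u₁ * W.u₂ * W.v * t
        + c 0 * W.u₁ * W.u₂ ^ 2 * W.v * t ^ 2 + c 1 * W.u₁ * W.u₂ * W.v ^ 2 * t
        + c 3 * W.u₁ ^ 2 * W.u₂ * W.v + c 4 * t ^ 3 + c 5 * W.u₁ ^ 3 * W.u₂ * t ^ 5
        + c 6 * W.u₁ ^ 2 * W.u₂ * W.w₁ * t ^ 4 + c 6 * W.u₂ * t ^ 4 + c 5 * W.v * t ^ 3 = 0 := by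
  have hT1 : termsN blkD' (Face.side (1, 0) .N) (0, 0) (depth blkD') 3 =
      [⟨0, 1, 0, 0, 0, 0, 2⟩, ⟨2, 1, 0, 1, 0, 0, 2⟩, ⟨1, 1, 1, 0, 0, 0, 1⟩, ⟨3, 2, 0, 0, 0, 0,
          3⟩, ⟨3, 1, 1, 1, 0, 0, 1⟩, ⟨2, 1, 2, 1, 0, 0, 2⟩, ⟨1, 1, 1, 2, 0, 0, 1⟩, ⟨0, 2, 1, 1,
          0, 0, 0⟩] := by
    decide
  have hT2 : termsN blkD' (Face.side (1, 0) .N) (1, 0) (depth blkD') 3 =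
      [⟨1, 0, 0, 0, 0, 0, 3⟩, ⟨2, 1, 0, 0, 0, 0, 2⟩, ⟨3, 3, 1, 0, 0, 0, 5⟩, ⟨0, 2, 1, 0, 1, 0,
          4⟩, ⟨0, 0, 1, 0, 0, 0, 4⟩, ⟨3, 0, 0, 1, 0, 0, 3⟩, ⟨2, 2, 1, 1, 0, 0, 0⟩] := by
    decide
  have h1 := vertexFunctional_mul_pow_eq_rowSumN W ht (leftCoeff c (c 3)) blkD' (Face.side (1,
      0) .N) (0, 0) 3
    (by decide)
  have h2 := vertexFunctional_mul_pow_eq_rowSumN W ht (rightCoeff c 0) blkD' (Face.side (1,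
      0) .N) (1, 0) 3
    (by decide)
  have h := split_blkD'_N hrel (a := Face.side (1, 0) .N) (by decide)
  have h' : vertexFunctional W t (leftCoeff c (c 3)) blkD' (Face.side (1, 0) .N) (0, 0) * t ^ 3 +
      vertexFunctional W t (rightCoeff c 0) blkD' (Face.side (1, 0) .N) (1, 0) * t ^ 3 = 0 := by
    rw [← add_mul, h, zero_mul]
  rw [h1, h2, hT1, hT2] at h'
  simp only [rowSumN, List.map_cons, List.map_nil, List.sum_cons, List.sum_nil, CWeights.mono,
      pow_zero,
    pow_one, mul_one, one_mul, leftCoeff, rightCoeff, Matrix.cons_val_zero, Matrix.cons_val_one,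
    Matrix.head_cons, Matrix.cons_val_two, Matrix.tail_cons, Matrix.cons_val_three, zero_mul,
    add_zero] at h'
  linear_combination h'

/-- ★ Instance on the upper block from the SOUTH side of `(1,0)` (8 + 7 walks, cleared by `t³`), incl. the walk doubling a co-corner plaquette (weight `w₂`). [cite: GlazmanManolescu2019, Lemma 2.1 (statement, "in the form given in [Gl]")] [cite: Glazman2015WeightedSAW, Lemma 3.1 (proof: the walks at one rhombus)] -/
private theorem instBlockS1 (hrel : ExactDominoVertexRelation W t c) (ht : t ≠ 0) :
    c 3 * W.u₂ * t ^ 4 + c 0 * W.u₂ * W.v * t ^ 4 + c 2 * W.u₁ * W.u₂ * t ^ 5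
        + c 1 * W.u₂ ^ 2 * t ^ 3 + c 1 * W.u₁ * W.u₂ * W.v * t ^ 5
        + c 0 * W.u₁ ^ 2 * W.u₂ * W.v * t ^ 4 + c 2 * W.u₁ * W.u₂ * W.v ^ 2 * t ^ 5
        + c 3 * W.u₁ * W.u₂ ^ 2 * W.v * t ^ 6 + c 5 * t ^ 3 + c 4 * W.u₁ * W.u₂ ^ 3 * t
        + c 6 * W.u₁ * W.u₂ ^ 2 * W.w₂ * t ^ 2 + c 6 * W.u₁ * t ^ 2 + c 4 * W.v * t ^ 3 = 0 := by
  have hT1 : termsN blkD (Face.side (1, 0) .S) (0, 0) (depth blkD) 3 =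
      [⟨0, 0, 1, 0, 0, 0, 4⟩, ⟨2, 0, 1, 1, 0, 0, 4⟩, ⟨3, 1, 1, 0, 0, 0, 5⟩, ⟨1, 0, 2, 0, 0, 0,
          3⟩, ⟨1, 1, 1, 1, 0, 0, 5⟩, ⟨2, 2, 1, 1, 0, 0, 4⟩, ⟨3, 1, 1, 2, 0, 0, 5⟩, ⟨0, 1, 2, 1,
          0, 0, 6⟩] := by
    decide
  have hT2 : termsN blkD (Face.side (1, 0) .S) (1, 0) (depth blkD) 3 =
      [⟨3, 0, 0, 0, 0, 0, 3⟩, ⟨2, 0, 1, 0, 0, 0, 4⟩, ⟨1, 1, 3, 0, 0, 0, 1⟩, ⟨0, 1, 2, 0, 0, 1,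
          2⟩, ⟨0, 1, 0, 0, 0, 0, 2⟩, ⟨1, 0, 0, 1, 0, 0, 3⟩, ⟨2, 1, 2, 1, 0, 0, 6⟩] := by
    decide
  have h1 := vertexFunctional_mul_pow_eq_rowSumN W ht (leftCoeff c (c 3)) blkD (Face.side (1,
      0) .S) (0, 0) 3
    (by decide)
  have h2 := vertexFunctional_mul_pow_eq_rowSumN W ht (rightCoeff c 0) blkD (Face.side (1,
      0) .S) (1, 0) 3
    (by decide)
  have h := split_blkD_S hrel (a := Face.side (1, 0) .S) (by decide)
  have h' : vertexFunctional W t (leftCoeff c (c 3)) blkD (Face.side (1, 0) .S) (0, 0) * t ^ 3 +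
      vertexFunctional W t (rightCoeff c 0) blkD (Face.side (1, 0) .S) (1, 0) * t ^ 3 = 0 := by
    rw [← add_mul, h, zero_mul]
  rw [h1, h2, hT1, hT2] at h'
  simp only [rowSumN, List.map_cons, List.map_nil, List.sum_cons, List.sum_nil, CWeights.mono,
      pow_zero,
    pow_one, mul_one, one_mul, leftCoeff, rightCoeff, Matrix.cons_val_zero, Matrix.cons_val_one,
    Matrix.head_cons, Matrix.cons_val_two, Matrix.tail_cons, Matrix.cons_val_three, zero_mul,
    add_zero] at h'
  linear_combination h'

/-- ★ The half-turn image: instance on the lower block from the NORTH side of `(0,0)`. [cite: GlazmanManolescu2019, Lemma 2.1 (statement, "in the form given in [Gl]")] [cite: Glazman2015WeightedSAW, Lemma 3.1 (proof: the walks at one rhombus)] -/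
private theorem instBlockN0 (hrel : ExactDominoVertexRelation W t c) (ht : t ≠ 0) :
    c 1 * t ^ 3 + c 0 * W.u₁ * t ^ 2 + c 3 * W.u₂ * t ^ 4 + c 2 * W.u₁ * W.u₂ ^ 3 * t
        + c 0 * W.u₁ * W.u₂ ^ 2 * W.w₂ * t ^ 2 + c 2 * W.v * t ^ 3
        + c 3 * W.u₁ * W.u₂ ^ 2 * W.v * t ^ 6 + c 6 * W.u₂ * W.v * t ^ 4
        + c 4 * W.u₁ * W.u₂ * t ^ 5 + c 5 * W.u₂ ^ 2 * t ^ 3 + c 5 * W.u₁ * W.u₂ * W.v * t ^ 5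
        + c 6 * W.u₁ ^ 2 * W.u₂ * W.v * t ^ 4 + c 4 * W.u₁ * W.u₂ * W.v ^ 2 * t ^ 5 = 0 := by
  have hT1 : termsN blkD' (Face.side (0, 0) .N) (0, 0) (depth blkD') 3 =
      [⟨1, 0, 0, 0, 0, 0, 3⟩, ⟨2, 1, 0, 0, 0, 0, 2⟩, ⟨0, 0, 1, 0, 0, 0, 4⟩, ⟨3, 1, 3, 0, 0, 0,
          1⟩, ⟨2, 1, 2, 0, 0, 1, 2⟩, ⟨3, 0, 0, 1, 0, 0, 3⟩, ⟨0, 1, 2, 1, 0, 0, 6⟩] := by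
    decide
  have hT2 : termsN blkD' (Face.side (0, 0) .N) (1, 0) (depth blkD') 3 =
      [⟨2, 0, 1, 0, 0, 0, 4⟩, ⟨0, 0, 1, 1, 0, 0, 4⟩, ⟨1, 1, 1, 0, 0, 0, 5⟩, ⟨3, 0, 2, 0, 0, 0,
          3⟩, ⟨3, 1, 1, 1, 0, 0, 5⟩, ⟨2, 1, 2, 1, 0, 0, 6⟩, ⟨0, 2, 1, 1, 0, 0, 4⟩, ⟨1, 1, 1, 2,
          0, 0, 5⟩] := by
    decide
  have h1 := vertexFunctional_mul_pow_eq_rowSumN W ht (leftCoeff c (c 3)) blkD' (Face.side (0,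
      0) .N) (0, 0) 3
    (by decide)
  have h2 := vertexFunctional_mul_pow_eq_rowSumN W ht (rightCoeff c 0) blkD' (Face.side (0,
      0) .N) (1, 0) 3
    (by decide)
  have h := split_blkD'_N hrel (a := Face.side (0, 0) .N) (by decide)
  have h' : vertexFunctional W t (leftCoeff c (c 3)) blkD' (Face.side (0, 0) .N) (0, 0) * t ^ 3 +
      vertexFunctional W t (rightCoeff c 0) blkD' (Face.side (0, 0) .N) (1, 0) * t ^ 3 = 0 := by
    rw [← add_mul, h, zero_mul]
  rw [h1, h2, hT1, hT2] at h'
  simp only [rowSumN, List.map_cons, List.map_nil, List.sum_cons, List.sum_nil, CWeights.mono,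
      pow_zero,
    pow_one, mul_one, one_mul, leftCoeff, rightCoeff, Matrix.cons_val_zero, Matrix.cons_val_one,
    Matrix.head_cons, Matrix.cons_val_two, Matrix.tail_cons, Matrix.cons_val_three, zero_mul,
    add_zero] at h'
  linear_combination h'

/-- ★★ **Sharper generic triviality**: `u₁u₂ ≠ 0`, `t ≠ 0`; if ONE of the three antisymmetric determinants
and ONE of the three symmetric determinants is nonzero, every exact domino relation is trivial.
[cite: Glazman2015WeightedSAW, Lemma 3.1 (proof: "solving this linear system")] [cite: IkhlefCardy2009, §3 (determinant of the local linear system)] -/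
theorem eq_zero_of_exactDominoVertexRelation_sharp (ht : t ≠ 0) (h1 : W.u₁ ≠ 0) (h2 : W.u₂ ≠ 0)
    (hA : dominoDetA W t ≠ 0 ∨ dominoDetA2 W t ≠ 0 ∨ dominoDetA3 W t ≠ 0)
    (hS : dominoDetS W t ≠ 0 ∨ dominoDetS2 W t ≠ 0 ∨ dominoDetS3 W t ≠ 0)
    (hrel : ExactDominoVertexRelation W t c) : c = 0 := by
  obtain ⟨rW, rN, rS, rE, rN', rS'⟩ := dominoRows_of_exactDominoVertexRelation hrel ht
  have eLW : c 0 * t ^ 2 + c 2 * W.u₂ * t + c 1 * W.u₁ * t ^ 3 + c 3 * W.v * t ^ 2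
      + c 6 * W.v ^ 2 * t ^ 2 + c 5 * W.u₂ * W.v * t
      + c 4 * W.u₁ * W.v * t ^ 3 = 0 := by rw [← rowLW_mul (W := W) (c := c) ht, rW, zero_mul]
  have eLN : c 1 * t ^ 2 + c 0 * W.u₁ * t + c 2 * W.v * t ^ 2 + c 3 * W.u₂ * t ^ 3
      + c 6 * W.u₂ * W.v * t ^ 3 + c 5 * W.u₂ ^ 2 * t ^ 2
      + c 4 * W.u₁ * W.u₂ * t ^ 4 = 0 := by rw [← rowLN_mul (W := W) (c := c) ht, rN, zero_mul]
  have eLS : c 2 * t ^ 2 + c 0 * W.u₂ * t ^ 3 + c 1 * W.v * t ^ 2 + c 3 * W.u₁ * t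
      + c 6 * W.u₁ * W.v * t + c 5 * W.u₁ * W.u₂
      + c 4 * W.u₁ ^ 2 * t ^ 2 = 0 := by rw [← rowLS_mul (W := W) (c := c) ht, rS, zero_mul]
  have eRE : c 6 * t ^ 2 + c 4 * W.u₂ * t + c 5 * W.u₁ * t ^ 3 + c 3 * W.v * t ^ 2
      + c 0 * W.v ^ 2 * t ^ 2 + c 1 * W.u₂ * W.v * t
      + c 2 * W.u₁ * W.v * t ^ 3 = 0 := by rw [← rowRE_mul (W := W) (c := c) ht, rE, zero_mul]
  have eRN : c 4 * t ^ 2 + c 6 * W.u₂ * t ^ 3 + c 5 * W.v * t ^ 2 + c 3 * W.u₁ * t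
      + c 0 * W.u₁ * W.v * t + c 1 * W.u₁ * W.u₂
      + c 2 * W.u₁ ^ 2 * t ^ 2 = 0 := by rw [← rowRN_mul (W := W) (c := c) ht, rN', zero_mul]
  have eRS : c 5 * t ^ 2 + c 6 * W.u₁ * t + c 4 * W.v * t ^ 2 + c 3 * W.u₂ * t ^ 3
      + c 0 * W.u₂ * W.v * t ^ 3 + c 1 * W.u₂ ^ 2 * t ^ 2
      + c 2 * W.u₁ * W.u₂ * t ^ 4 = 0 := by rw [← rowRS_mul (W := W) (c := c) ht, rS', zero_mul]
  have b1 := instBlockW hrel ht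
  have b2 := instBlockE hrel ht
  have b3 := instBlockS hrel ht
  have b4 := instBlockN hrel ht
  have b5 := instBlockS1 hrel ht
  have b6 := instBlockN0 hrel ht
  have ka0 : t ^ 2 * dominoDetA W t * (c 0 - c 6) = 0 := by
    rw [dominoDetA]
    linear_combination (t ^ 4 - (W.v ^ 2 * t ^ 4) - (W.u₂ ^ 2 * t ^ 4)
        + W.u₁ * W.u₂ * W.v * t ^ 2 + W.u₁ * W.u₂ * W.v * t ^ 6 - (W.u₁ ^ 2 * t ^ 4)) * (eLW
        - eRE) + (2 * W.u₂ * W.v * t ^ 3 - (W.u₁ * t ^ 5) - (W.u₁ * W.v ^ 2 * t ^ 5)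
        - (W.u₁ * W.u₂ ^ 2 * t) + W.u₁ ^ 3 * t ^ 5) * (eLN - eRS) +
      (-(W.u₂ * t ^ 3) - (W.u₂ * W.v ^ 2 * t ^ 3) + W.u₂ ^ 3 * t ^ 3 + 2 * W.u₁ * W.v * t ^ 5
          - (W.u₁ ^ 2 * W.u₂ * t ^ 7)) * (eLS - eRN)
  have ka1 : t ^ 2 * dominoDetA W t * (c 1 - c 5) = 0 := by
    rw [dominoDetA]
    linear_combination (2 * W.u₂ * W.v * t ^ 5 - (W.u₁ * t ^ 3) - (W.u₁ * W.v ^ 2 * t ^ 3)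
        - (W.u₁ * W.u₂ ^ 2 * t ^ 7) + W.u₁ ^ 3 * t ^ 3) * (eLW - eRE) + (t ^ 4
        - (W.v ^ 2 * t ^ 4) - (W.u₂ ^ 2 * t ^ 4) + W.u₁ * W.u₂ * W.v * t ^ 2
        + W.u₁ * W.u₂ * W.v * t ^ 6 - (W.u₁ ^ 2 * t ^ 4)) * (eLN - eRS) +
      (-(W.v * t ^ 4) + W.v ^ 3 * t ^ 4 - (W.u₂ ^ 2 * W.v * t ^ 4) + W.u₁ * W.u₂ * t ^ 2
          + W.u₁ * W.u₂ * t ^ 6 - (W.u₁ ^ 2 * W.v * t ^ 4)) * (eLS - eRN)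
  have ka2 : t ^ 2 * dominoDetA W t * (c 2 - c 4) = 0 := by
    rw [dominoDetA]
    linear_combination (-(W.u₂ * t ^ 5) - (W.u₂ * W.v ^ 2 * t ^ 5) + W.u₂ ^ 3 * t ^ 5
        + 2 * W.u₁ * W.v * t ^ 3 - (W.u₁ ^ 2 * W.u₂ * t)) * (eLW - eRE) + (-(W.v * t ^ 4)
        + W.v ^ 3 * t ^ 4 - (W.u₂ ^ 2 * W.v * t ^ 4) + W.u₁ * W.u₂ * t ^ 2
        + W.u₁ * W.u₂ * t ^ 6 - (W.u₁ ^ 2 * W.v * t ^ 4)) * (eLN - eRS) +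
      (t ^ 4 - (W.v ^ 2 * t ^ 4) - (W.u₂ ^ 2 * t ^ 4) + W.u₁ * W.u₂ * W.v * t ^ 2
          + W.u₁ * W.u₂ * W.v * t ^ 6 - (W.u₁ ^ 2 * t ^ 4)) * (eLS - eRN)
  have kb0 : W.u₁ ^ 2 * W.u₂ * t ^ 3 * dominoDetA2 W t * (c 0 - c 6) = 0 := by
    rw [dominoDetA2]
    linear_combination (W.u₁ ^ 2 * W.u₂ ^ 2 * W.v * t - (W.u₁ ^ 3 * W.u₂ * t ^ 7)
        - (W.u₁ ^ 3 * W.u₂ * W.v ^ 2 * t ^ 3) + W.u₁ ^ 5 * W.u₂ * t ^ 7) * (eLW - eRE)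
        + (2 * W.u₂ * W.v * t ^ 4 - (W.u₁ * t ^ 6) - (W.u₁ * W.v ^ 2 * t ^ 6)
        - (W.u₁ * W.u₂ ^ 2 * t ^ 2) - 2 * W.u₁ * W.u₂ ^ 2 * W.v ^ 2 * t ^ 2
        + W.u₁ ^ 2 * W.u₂ * W.v * t ^ 4 + W.u₁ ^ 2 * W.u₂ * W.v ^ 3 * t ^ 4 + W.u₁ ^ 3 * t ^ 6
        + W.u₁ ^ 3 * W.u₂ ^ 2 * t ^ 6 - (W.u₁ ^ 4 * W.u₂ * W.v * t ^ 8)) * (eLS - eRN) +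
      (-2 * W.u₂ * W.v * t ^ 3 + W.u₁ * t ^ 5 + W.u₁ * W.v ^ 2 * t ^ 5 + W.u₁ * W.u₂ ^ 2 * t
          - (W.u₁ ^ 3 * t ^ 5)) * (b3 - b4)
  have kb1 : W.u₁ ^ 2 * W.u₂ * t ^ 3 * dominoDetA2 W t * (c 1 - c 5) = 0 := by
    rw [dominoDetA2]
    linear_combination (W.u₁ ^ 2 * W.u₂ * W.w₁ * t ^ 6 - (W.u₁ ^ 2 * W.u₂ * W.v ^ 2 * t ^ 2)
        + W.u₁ ^ 3 * W.u₂ ^ 2 * W.v * t ^ 4 - (W.u₁ ^ 4 * W.u₂ * W.w₁ * t ^ 6)) * (eLW - eRE)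
        + (t ^ 5 - (W.v ^ 2 * t ^ 5) - (W.u₂ ^ 2 * t ^ 5) + W.u₁ * W.u₂ * W.v * t ^ 7
        + W.u₁ * W.u₂ * W.v ^ 3 * t ^ 3 + W.u₁ * W.u₂ ^ 3 * W.v * t ^ 3 - (W.u₁ ^ 2 * t ^ 5)
        - (W.u₁ ^ 2 * W.u₂ ^ 2 * W.w₁ * t ^ 5) - (W.u₁ ^ 2 * W.u₂ ^ 2 * W.v ^ 2 * t ^ 5)
        + W.u₁ ^ 3 * W.u₂ * W.v * W.w₁ * t ^ 7) * (eLS - eRN) +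
      (-(t ^ 4) + W.v ^ 2 * t ^ 4 + W.u₂ ^ 2 * t ^ 4 - (W.u₁ * W.u₂ * W.v * t ^ 2)
          - (W.u₁ * W.u₂ * W.v * t ^ 6) + W.u₁ ^ 2 * t ^ 4) * (b3 - b4)
  have kb2 : W.u₁ ^ 2 * W.u₂ * t ^ 3 * dominoDetA2 W t * (c 2 - c 4) = 0 := by
    rw [dominoDetA2]
    linear_combination (-(W.u₁ ^ 2 * W.u₂ * W.v * W.w₁ * t ^ 6)
        + W.u₁ ^ 2 * W.u₂ * W.v ^ 3 * t ^ 2 - (W.u₁ ^ 2 * W.u₂ ^ 3 * W.v * t ^ 2)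
        + W.u₁ ^ 3 * W.u₂ ^ 2 * t ^ 8 + W.u₁ ^ 3 * W.u₂ ^ 2 * W.w₁ * t ^ 4
        - (W.u₁ ^ 4 * W.u₂ * W.v * t ^ 6)) * (eLW - eRE) + (-(W.v * t ^ 5) + W.v ^ 3 * t ^ 5
        - (W.u₂ ^ 2 * W.v * t ^ 5) + W.u₁ * W.u₂ * t ^ 3 + W.u₁ * W.u₂ * t ^ 7
        + W.u₁ * W.u₂ * W.v ^ 2 * t ^ 3 - (W.u₁ * W.u₂ * W.v ^ 4 * t ^ 3)
        + W.u₁ * W.u₂ ^ 3 * W.v ^ 2 * t ^ 3 - (W.u₁ ^ 2 * W.v * t ^ 5)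
        - (W.u₁ ^ 2 * W.u₂ ^ 2 * W.v * t ^ 5) - (W.u₁ ^ 2 * W.u₂ ^ 2 * W.v * W.w₁ * t ^ 5)
        - (W.u₁ ^ 3 * W.u₂ * t ^ 7) + W.u₁ ^ 3 * W.u₂ * W.w₁ * t ^ 7
        + W.u₁ ^ 3 * W.u₂ * W.v ^ 2 * t ^ 7) * (eLS - eRN) +
      (W.v * t ^ 4 - (W.v ^ 3 * t ^ 4) + W.u₂ ^ 2 * W.v * t ^ 4 - (W.u₁ * W.u₂ * t ^ 2)
          - (W.u₁ * W.u₂ * t ^ 6) + W.u₁ ^ 2 * W.v * t ^ 4) * (b3 - b4)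
  have kc0 : W.u₁ * W.u₂ ^ 2 * t ^ 3 * dominoDetA3 W t * (c 0 - c 6) = 0 := by
    rw [dominoDetA3]
    linear_combination (-(W.u₁ * W.u₂ ^ 3 * t ^ 3) - (W.u₁ * W.u₂ ^ 3 * W.v ^ 2 * t ^ 7)
        + W.u₁ * W.u₂ ^ 5 * t ^ 3 + W.u₁ ^ 2 * W.u₂ ^ 2 * W.v * t ^ 9) * (eLW - eRE)
        + (-(W.u₂ * t ^ 4) - (W.u₂ * W.v ^ 2 * t ^ 4) + W.u₂ ^ 3 * t ^ 4
        + 2 * W.u₁ * W.v * t ^ 6 + W.u₁ * W.u₂ ^ 2 * W.v * t ^ 6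
        + W.u₁ * W.u₂ ^ 2 * W.v ^ 3 * t ^ 6 - (W.u₁ * W.u₂ ^ 4 * W.v * t ^ 2)
        - (W.u₁ ^ 2 * W.u₂ * t ^ 8) - 2 * W.u₁ ^ 2 * W.u₂ * W.v ^ 2 * t ^ 8
        + W.u₁ ^ 2 * W.u₂ ^ 3 * t ^ 4) * (eLN - eRS) +
      (-(W.u₂ * t ^ 3) - (W.u₂ * W.v ^ 2 * t ^ 3) + W.u₂ ^ 3 * t ^ 3 + 2 * W.u₁ * W.v * t ^ 5
          - (W.u₁ ^ 2 * W.u₂ * t ^ 7)) * (b5 - b6)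
  have kc1 : W.u₁ * W.u₂ ^ 2 * t ^ 3 * dominoDetA3 W t * (c 1 - c 5) = 0 := by
    rw [dominoDetA3]
    linear_combination (-(W.u₁ * W.u₂ ^ 2 * W.v * W.w₂ * t ^ 4)
        + W.u₁ * W.u₂ ^ 2 * W.v ^ 3 * t ^ 8 - (W.u₁ * W.u₂ ^ 4 * W.v * t ^ 4)
        + W.u₁ ^ 2 * W.u₂ ^ 3 * t ^ 2 + W.u₁ ^ 2 * W.u₂ ^ 3 * W.w₂ * t ^ 6
        - (W.u₁ ^ 3 * W.u₂ ^ 2 * W.v * t ^ 8)) * (eLW - eRE) + (-(W.v * t ^ 5)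
        + W.v ^ 3 * t ^ 5 - (W.u₂ ^ 2 * W.v * t ^ 5) + W.u₁ * W.u₂ * t ^ 3
        + W.u₁ * W.u₂ * t ^ 7 + W.u₁ * W.u₂ * W.v ^ 2 * t ^ 7 - (W.u₁ * W.u₂ * W.v ^ 4 * t ^ 7)
        - (W.u₁ * W.u₂ ^ 3 * t ^ 3) + W.u₁ * W.u₂ ^ 3 * W.w₂ * t ^ 3
        + W.u₁ * W.u₂ ^ 3 * W.v ^ 2 * t ^ 3 - (W.u₁ ^ 2 * W.v * t ^ 5)
        - (W.u₁ ^ 2 * W.u₂ ^ 2 * W.v * t ^ 5) - (W.u₁ ^ 2 * W.u₂ ^ 2 * W.v * W.w₂ * t ^ 5)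
        + W.u₁ ^ 3 * W.u₂ * W.v ^ 2 * t ^ 7) * (eLN - eRS) +
      (-(W.v * t ^ 4) + W.v ^ 3 * t ^ 4 - (W.u₂ ^ 2 * W.v * t ^ 4) + W.u₁ * W.u₂ * t ^ 2
          + W.u₁ * W.u₂ * t ^ 6 - (W.u₁ ^ 2 * W.v * t ^ 4)) * (b5 - b6)
  have kc2 : W.u₁ * W.u₂ ^ 2 * t ^ 3 * dominoDetA3 W t * (c 2 - c 4) = 0 := by
    rw [dominoDetA3]
    linear_combination (W.u₁ * W.u₂ ^ 2 * W.w₂ * t ^ 4 - (W.u₁ * W.u₂ ^ 2 * W.v ^ 2 * t ^ 8)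
        - (W.u₁ * W.u₂ ^ 4 * W.w₂ * t ^ 4) + W.u₁ ^ 2 * W.u₂ ^ 3 * W.v * t ^ 6) * (eLW - eRE)
        + (t ^ 5 - (W.v ^ 2 * t ^ 5) - (W.u₂ ^ 2 * t ^ 5) + W.u₁ * W.u₂ * W.v * t ^ 3
        + W.u₁ * W.u₂ * W.v ^ 3 * t ^ 7 + W.u₁ * W.u₂ ^ 3 * W.v * W.w₂ * t ^ 3
        - (W.u₁ ^ 2 * t ^ 5) - (W.u₁ ^ 2 * W.u₂ ^ 2 * W.w₂ * t ^ 5)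
        - (W.u₁ ^ 2 * W.u₂ ^ 2 * W.v ^ 2 * t ^ 5) + W.u₁ ^ 3 * W.u₂ * W.v * t ^ 7) * (eLN - eRS) +
      (t ^ 4 - (W.v ^ 2 * t ^ 4) - (W.u₂ ^ 2 * t ^ 4) + W.u₁ * W.u₂ * W.v * t ^ 2
          + W.u₁ * W.u₂ * W.v * t ^ 6 - (W.u₁ ^ 2 * t ^ 4)) * (b5 - b6)
  have ks0 : 2 * W.u₁ ^ 2 * W.u₂ * t ^ 3 * dominoDetS W t * (c 0 + c 6) = 0 := by
    rw [dominoDetS]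
    linear_combination (2 * W.v * t ^ 7 - 2 * W.v ^ 3 * t ^ 7 + 2 * W.u₂ ^ 2 * W.v * t ^ 7
        - 2 * W.u₁ * W.u₂ * t ^ 5 - 2 * W.u₁ * W.u₂ * t ^ 9 + 2 * W.u₁ ^ 2 * W.v * t ^ 7
        - 2 * W.u₁ ^ 2 * W.u₂ ^ 2 * W.v * t ^ 11 + 2 * W.u₁ ^ 2 * W.u₂ ^ 2 * W.v * W.w₁ * t ^ 7
        - 2 * W.u₁ ^ 3 * W.u₂ * W.w₁ * t ^ 5 + 2 * W.u₁ ^ 3 * W.u₂ * W.v ^ 2 * t ^ 9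
        + 2 * W.u₁ ^ 3 * W.u₂ ^ 3 * t ^ 5 - 2 * W.u₁ ^ 4 * W.u₂ ^ 2 * W.v * t ^ 3
        - 2 * W.u₁ ^ 4 * W.u₂ ^ 2 * W.v * t ^ 7 + 2 * W.u₁ ^ 5 * W.u₂ * t ^ 5) * (eLW + eRE)
        + (2 * W.u₁ ^ 2 * W.u₂ * W.v ^ 2 * t ^ 10
        - 2 * W.u₁ ^ 2 * W.u₂ * W.v ^ 2 * W.w₁ * t ^ 6 - 2 * W.u₁ ^ 3 * W.u₂ ^ 2 * W.v * t ^ 4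
        - 2 * W.u₁ ^ 3 * W.u₂ ^ 2 * W.v * t ^ 8 + 2 * W.u₁ ^ 4 * W.u₂ * W.w₁ * t ^ 6
        + 2 * W.u₁ ^ 4 * W.u₂ * W.v ^ 2 * t ^ 6 + 2 * W.u₁ ^ 4 * W.u₂ ^ 3 * t ^ 2
        - 2 * W.u₁ ^ 6 * W.u₂ * t ^ 6) * (eLN + eRS) +
      (2 * W.u₁ ^ 2 * W.u₂ * W.v * t ^ 6 + 2 * W.u₁ ^ 2 * W.u₂ * W.v * W.w₁ * t ^ 6
          - 2 * W.u₁ ^ 2 * W.u₂ * W.v ^ 3 * t ^ 6 - 2 * W.u₁ ^ 2 * W.u₂ * W.v ^ 3 * t ^ 10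
          + 2 * W.u₁ ^ 2 * W.u₂ ^ 3 * W.v * t ^ 6 + 2 * W.u₁ ^ 2 * W.u₂ ^ 3 * W.v * t ^ 10
          - 2 * W.u₁ ^ 3 * W.u₂ ^ 2 * t ^ 4 - 2 * W.u₁ ^ 3 * W.u₂ ^ 2 * t ^ 8
          - 2 * W.u₁ ^ 3 * W.u₂ ^ 2 * W.w₁ * t ^ 8 + 2 * W.u₁ ^ 3 * W.u₂ ^ 2 * W.v ^ 2 * t ^ 4
          - 2 * W.u₁ ^ 3 * W.u₂ ^ 4 * t ^ 4 + 2 * W.u₁ ^ 5 * W.u₂ ^ 2 * t ^ 8) * (eLS + eRN)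
          + (-2 * W.v * t ^ 6 + 2 * W.v ^ 3 * t ^ 6 - 2 * W.u₂ ^ 2 * W.v * t ^ 6
          + 2 * W.u₁ * W.u₂ * t ^ 4 + 2 * W.u₁ * W.u₂ * t ^ 8
          - 2 * W.u₁ ^ 2 * W.v * t ^ 6) * (b1 + b2)
  have ks1 : 2 * W.u₁ ^ 2 * W.u₂ * t ^ 3 * dominoDetS W t * (c 1 + c 5) = 0 := by
    rw [dominoDetS]
    linear_combination (2 * W.u₂ * t ^ 8 + 2 * W.u₂ * W.v ^ 2 * t ^ 8 - 2 * W.u₂ ^ 3 * t ^ 8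
        - 4 * W.u₁ * W.v * t ^ 6 + 2 * W.u₁ ^ 2 * W.u₂ * t ^ 4
        - 2 * W.u₁ ^ 2 * W.u₂ ^ 3 * W.w₁ * t ^ 8 - 2 * W.u₁ ^ 3 * W.u₂ ^ 2 * W.v * t ^ 6
        + 2 * W.u₁ ^ 4 * W.u₂ * W.w₁ * t ^ 4 + 2 * W.u₁ ^ 4 * W.u₂ * W.v ^ 2 * t ^ 4
        + 2 * W.u₁ ^ 4 * W.u₂ ^ 3 * t ^ 8 - 2 * W.u₁ ^ 6 * W.u₂ * t ^ 4) * (eLW + eRE)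
        + (2 * W.u₁ ^ 2 * W.u₂ ^ 2 * W.v * W.w₁ * t ^ 7 - 2 * W.u₁ ^ 3 * W.u₂ * W.w₁ * t ^ 5
        + 2 * W.u₁ ^ 3 * W.u₂ * W.v ^ 2 * t ^ 5 - 2 * W.u₁ ^ 4 * W.u₂ ^ 2 * W.v * t ^ 3
        - 2 * W.u₁ ^ 4 * W.u₂ ^ 2 * W.v * t ^ 7 + 2 * W.u₁ ^ 5 * W.u₂ * t ^ 5) * (eLN + eRS) +
      (2 * W.u₁ ^ 2 * W.u₂ ^ 2 * t ^ 7 + 2 * W.u₁ ^ 2 * W.u₂ ^ 2 * W.w₁ * t ^ 7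
          + 2 * W.u₁ ^ 2 * W.u₂ ^ 2 * W.v ^ 2 * t ^ 7 - 2 * W.u₁ ^ 2 * W.u₂ ^ 4 * t ^ 7
          - 4 * W.u₁ ^ 3 * W.u₂ * W.v * t ^ 5 - 2 * W.u₁ ^ 3 * W.u₂ * W.v * W.w₁ * t ^ 5
          - 2 * W.u₁ ^ 3 * W.u₂ * W.v ^ 3 * t ^ 5 + 2 * W.u₁ ^ 3 * W.u₂ ^ 3 * W.v * t ^ 5
          + 2 * W.u₁ ^ 4 * W.u₂ ^ 2 * t ^ 3 - 2 * W.u₁ ^ 4 * W.u₂ ^ 2 * t ^ 7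
          + 2 * W.u₁ ^ 5 * W.u₂ * W.v * t ^ 5) * (eLS + eRN) + (-2 * W.u₂ * t ^ 7
          - 2 * W.u₂ * W.v ^ 2 * t ^ 7 + 2 * W.u₂ ^ 3 * t ^ 7 + 4 * W.u₁ * W.v * t ^ 5
          - 2 * W.u₁ ^ 2 * W.u₂ * t ^ 3) * (b1 + b2)
  have ks2 : 2 * W.u₁ ^ 2 * W.u₂ * t ^ 3 * dominoDetS W t * (c 2 + c 4) = 0 := by
    rw [dominoDetS]
    linear_combination (-4 * W.u₂ * W.v * t ^ 8 + 2 * W.u₁ * t ^ 6 + 2 * W.u₁ * W.v ^ 2 * t ^ 6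
        + 2 * W.u₁ * W.u₂ ^ 2 * t ^ 10 + 2 * W.u₁ ^ 2 * W.u₂ ^ 3 * W.v * t ^ 12
        - 2 * W.u₁ ^ 3 * t ^ 6 + 2 * W.u₁ ^ 3 * W.u₂ ^ 2 * W.v ^ 2 * t ^ 6
        - 2 * W.u₁ ^ 3 * W.u₂ ^ 4 * t ^ 6 - 2 * W.u₁ ^ 4 * W.u₂ * W.v * t ^ 4
        - 2 * W.u₁ ^ 4 * W.u₂ * W.v * t ^ 8 + 2 * W.u₁ ^ 5 * W.u₂ ^ 2 * t ^ 2) * (eLW + eRE)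
        + (-2 * W.u₁ ^ 2 * W.u₂ ^ 2 * W.v ^ 2 * t ^ 11 + 2 * W.u₁ ^ 3 * W.u₂ * W.v * t ^ 9
        - 2 * W.u₁ ^ 3 * W.u₂ * W.v ^ 3 * t ^ 5 + 2 * W.u₁ ^ 3 * W.u₂ ^ 3 * W.v * t ^ 5
        - 2 * W.u₁ ^ 4 * W.u₂ ^ 2 * t ^ 3 + 2 * W.u₁ ^ 5 * W.u₂ * W.v * t ^ 5) * (eLN + eRS) +
      (-4 * W.u₁ ^ 2 * W.u₂ ^ 2 * W.v * t ^ 7 - 2 * W.u₁ ^ 2 * W.u₂ ^ 2 * W.v * t ^ 11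
          + 2 * W.u₁ ^ 3 * W.u₂ * t ^ 5 + 4 * W.u₁ ^ 3 * W.u₂ * W.v ^ 2 * t ^ 5
          + 2 * W.u₁ ^ 3 * W.u₂ * W.v ^ 2 * t ^ 9 + 2 * W.u₁ ^ 3 * W.u₂ ^ 3 * t ^ 5
          + 2 * W.u₁ ^ 3 * W.u₂ ^ 3 * t ^ 9 - 2 * W.u₁ ^ 4 * W.u₂ ^ 2 * W.v * t ^ 3
          - 2 * W.u₁ ^ 4 * W.u₂ ^ 2 * W.v * t ^ 7 - 2 * W.u₁ ^ 5 * W.u₂ * t ^ 5) * (eLS + eRN)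
          + (4 * W.u₂ * W.v * t ^ 7 - 2 * W.u₁ * t ^ 5 - 2 * W.u₁ * W.v ^ 2 * t ^ 5
          - 2 * W.u₁ * W.u₂ ^ 2 * t ^ 9 + 2 * W.u₁ ^ 3 * t ^ 5) * (b1 + b2)
  have ks3 : 2 * W.u₁ ^ 2 * W.u₂ * t ^ 3 * dominoDetS W t * (c 3) = 0 := by
    rw [dominoDetS]
    linear_combination (-(t ^ 7) + W.v ^ 4 * t ^ 7 - 2 * W.u₂ ^ 2 * W.v ^ 2 * t ^ 7
        + W.u₂ ^ 4 * t ^ 7 + 2 * W.u₁ * W.u₂ * W.v * t ^ 5 + 2 * W.u₁ * W.u₂ * W.v * t ^ 9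
        - 2 * W.u₁ ^ 2 * W.v ^ 2 * t ^ 7 - (W.u₁ ^ 2 * W.u₂ ^ 2 * t ^ 3)
        - (W.u₁ ^ 2 * W.u₂ ^ 2 * t ^ 11) + W.u₁ ^ 2 * W.u₂ ^ 2 * W.w₁ * t ^ 7
        - (W.u₁ ^ 2 * W.u₂ ^ 2 * W.v ^ 2 * W.w₁ * t ^ 7) + W.u₁ ^ 2 * W.u₂ ^ 4 * W.w₁ * t ^ 7
        + W.u₁ ^ 3 * W.u₂ * W.v * t ^ 5 + W.u₁ ^ 3 * W.u₂ * W.v * t ^ 9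
        - (W.u₁ ^ 3 * W.u₂ * W.v ^ 3 * t ^ 5) - (W.u₁ ^ 3 * W.u₂ * W.v ^ 3 * t ^ 9)
        + W.u₁ ^ 3 * W.u₂ ^ 3 * W.v * t ^ 5 - (W.u₁ ^ 3 * W.u₂ ^ 3 * W.v * t ^ 13)
        + W.u₁ ^ 4 * t ^ 7 - (W.u₁ ^ 4 * W.u₂ ^ 2 * t ^ 3) - (W.u₁ ^ 4 * W.u₂ ^ 2 * t ^ 7)
        - (W.u₁ ^ 4 * W.u₂ ^ 2 * W.w₁ * t ^ 3) + W.u₁ ^ 5 * W.u₂ * W.v * t ^ 5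
        + W.u₁ ^ 5 * W.u₂ * W.v * t ^ 9) * (eLW + eRE) + (-(W.u₁ ^ 2 * W.u₂ * W.v * t ^ 10)
        + W.u₁ ^ 2 * W.u₂ * W.v * W.w₁ * t ^ 6 - (W.u₁ ^ 2 * W.u₂ * W.v ^ 3 * t ^ 10)
        + W.u₁ ^ 2 * W.u₂ * W.v ^ 3 * W.w₁ * t ^ 6 + W.u₁ ^ 2 * W.u₂ ^ 3 * W.v * t ^ 10
        - (W.u₁ ^ 2 * W.u₂ ^ 3 * W.v * W.w₁ * t ^ 6) + W.u₁ ^ 3 * W.u₂ ^ 2 * t ^ 4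
        + W.u₁ ^ 3 * W.u₂ ^ 2 * W.w₁ * t ^ 4 - (W.u₁ ^ 3 * W.u₂ ^ 2 * W.w₁ * t ^ 8)
        + W.u₁ ^ 3 * W.u₂ ^ 2 * W.v ^ 2 * t ^ 4 + W.u₁ ^ 3 * W.u₂ ^ 2 * W.v ^ 2 * t ^ 8
        + W.u₁ ^ 3 * W.u₂ ^ 2 * W.v ^ 2 * t ^ 12 - (W.u₁ ^ 3 * W.u₂ ^ 4 * t ^ 4)
        - 2 * W.u₁ ^ 4 * W.u₂ * W.v * t ^ 6 - (W.u₁ ^ 4 * W.u₂ * W.v * t ^ 10)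
        - (W.u₁ ^ 4 * W.u₂ * W.v * W.w₁ * t ^ 6) + W.u₁ ^ 5 * W.u₂ ^ 2 * t ^ 8) * (eLN + eRS) +
      (-(W.u₁ ^ 2 * W.u₂ * t ^ 6) - (W.u₁ ^ 2 * W.u₂ * W.w₁ * t ^ 6)
          + W.u₁ ^ 2 * W.u₂ * W.v ^ 2 * t ^ 10 - (W.u₁ ^ 2 * W.u₂ * W.v ^ 2 * W.w₁ * t ^ 6)
          + W.u₁ ^ 2 * W.u₂ * W.v ^ 4 * t ^ 6 + W.u₁ ^ 2 * W.u₂ * W.v ^ 4 * t ^ 10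
          - (W.u₁ ^ 2 * W.u₂ ^ 3 * W.w₁ * t ^ 6) - 2 * W.u₁ ^ 2 * W.u₂ ^ 3 * W.v ^ 2 * t ^ 6
          - (W.u₁ ^ 2 * W.u₂ ^ 3 * W.v ^ 2 * t ^ 10) + W.u₁ ^ 2 * W.u₂ ^ 5 * t ^ 6
          + W.u₁ ^ 3 * W.u₂ ^ 2 * W.v * t ^ 8 + W.u₁ ^ 3 * W.u₂ ^ 2 * W.v * t ^ 12
          + W.u₁ ^ 3 * W.u₂ ^ 2 * W.v * W.w₁ * t ^ 4 + W.u₁ ^ 3 * W.u₂ ^ 2 * W.v * W.w₁ * t ^ 8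
          + W.u₁ ^ 4 * W.u₂ * t ^ 6 + W.u₁ ^ 4 * W.u₂ * W.w₁ * t ^ 6
          - (W.u₁ ^ 4 * W.u₂ * W.v ^ 2 * t ^ 6) - (W.u₁ ^ 4 * W.u₂ * W.v ^ 2 * t ^ 10)
          - (W.u₁ ^ 4 * W.u₂ ^ 3 * t ^ 10)) * (eLS + eRN) + (t ^ 6 - (W.v ^ 4 * t ^ 6)
          + 2 * W.u₂ ^ 2 * W.v ^ 2 * t ^ 6 - (W.u₂ ^ 4 * t ^ 6) - 2 * W.u₁ * W.u₂ * W.v * t ^ 4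
          - 2 * W.u₁ * W.u₂ * W.v * t ^ 8 + 2 * W.u₁ ^ 2 * W.v ^ 2 * t ^ 6
          + W.u₁ ^ 2 * W.u₂ ^ 2 * t ^ 2 + W.u₁ ^ 2 * W.u₂ ^ 2 * t ^ 10
          - (W.u₁ ^ 4 * t ^ 6)) * (b1 + b2)
  have kt0 : 2 * W.u₁ ^ 2 * W.u₂ * t ^ 2 * dominoDetS2 W t * (c 0 + c 6) = 0 := by
    rw [dominoDetS2]
    linear_combination (2 * W.u₁ ^ 2 * W.u₂ ^ 3 * W.v * t ^ 4
        - 2 * W.u₁ ^ 3 * W.u₂ ^ 2 * t ^ 10 - 2 * W.u₁ ^ 3 * W.u₂ ^ 2 * W.v ^ 2 * t ^ 2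
        - 2 * W.u₁ ^ 3 * W.u₂ ^ 2 * W.v ^ 2 * t ^ 6 + 2 * W.u₁ ^ 4 * W.u₂ * W.v * t ^ 4
        + 2 * W.u₁ ^ 4 * W.u₂ * W.v * t ^ 8) * (eLW + eRE)
        + (-2 * W.u₁ ^ 2 * W.u₂ ^ 2 * W.v ^ 2 * t ^ 3 + 2 * W.u₁ ^ 3 * W.u₂ * W.v * t ^ 9
        + 2 * W.u₁ ^ 3 * W.u₂ * W.v ^ 3 * t ^ 5 + 2 * W.u₁ ^ 3 * W.u₂ ^ 3 * W.v * t
        - 2 * W.u₁ ^ 4 * W.u₂ ^ 2 * t ^ 7 - 2 * W.u₁ ^ 5 * W.u₂ * W.v * t ^ 5) * (eLN + eRS) +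
      (2 * W.v * t ^ 7 - 2 * W.v ^ 3 * t ^ 7 + 2 * W.u₂ ^ 2 * W.v * t ^ 7
          - 2 * W.u₁ * W.u₂ * t ^ 5 - 2 * W.u₁ * W.u₂ * t ^ 9
          + 2 * W.u₁ * W.u₂ * W.v ^ 2 * t ^ 5 - 2 * W.u₁ * W.u₂ * W.v ^ 4 * t ^ 5
          + 2 * W.u₁ * W.u₂ ^ 3 * W.v ^ 2 * t ^ 5 + 2 * W.u₁ ^ 2 * W.v * t ^ 7
          - 2 * W.u₁ ^ 2 * W.u₂ ^ 2 * W.v * t ^ 3 - 2 * W.u₁ ^ 2 * W.u₂ ^ 2 * W.v * t ^ 7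
          + 2 * W.u₁ ^ 2 * W.u₂ ^ 2 * W.v ^ 3 * t ^ 3 - 2 * W.u₁ ^ 2 * W.u₂ ^ 4 * W.v * t ^ 3
          - 2 * W.u₁ ^ 3 * W.u₂ * W.v ^ 2 * t ^ 9 + 2 * W.u₁ ^ 3 * W.u₂ ^ 3 * t ^ 9
          + 2 * W.u₁ ^ 4 * W.u₂ ^ 2 * W.v * t ^ 7) * (eLS + eRN) + (-2 * W.v * t ^ 6
          + 2 * W.v ^ 3 * t ^ 6 - 2 * W.u₂ ^ 2 * W.v * t ^ 6 + 2 * W.u₁ * W.u₂ * t ^ 4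
          + 2 * W.u₁ * W.u₂ * t ^ 8 - 2 * W.u₁ ^ 2 * W.v * t ^ 6) * (b3 + b4)
  have kt1 : 2 * W.u₁ ^ 2 * W.u₂ * t ^ 2 * dominoDetS2 W t * (c 1 + c 5) = 0 := by
    rw [dominoDetS2]
    linear_combination (2 * W.u₁ ^ 2 * W.u₂ ^ 2 * W.w₁ * t ^ 9
        - 2 * W.u₁ ^ 2 * W.u₂ ^ 2 * W.v ^ 2 * t ^ 5 - 2 * W.u₁ ^ 3 * W.u₂ * W.v * W.w₁ * t ^ 7
        + 2 * W.u₁ ^ 3 * W.u₂ * W.v ^ 3 * t ^ 3 + 2 * W.u₁ ^ 3 * W.u₂ ^ 3 * W.v * t ^ 7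
        - 2 * W.u₁ ^ 5 * W.u₂ * W.v * t ^ 3) * (eLW + eRE)
        + (-2 * W.u₁ ^ 2 * W.u₂ * W.v * W.w₁ * t ^ 8 + 2 * W.u₁ ^ 2 * W.u₂ * W.v ^ 3 * t ^ 4
        + 2 * W.u₁ ^ 3 * W.u₂ ^ 2 * W.w₁ * t ^ 6 - 2 * W.u₁ ^ 3 * W.u₂ ^ 2 * W.v ^ 2 * t ^ 2
        - 2 * W.u₁ ^ 3 * W.u₂ ^ 2 * W.v ^ 2 * t ^ 6 + 2 * W.u₁ ^ 4 * W.u₂ * W.v * t ^ 4) * (eLN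
        + eRS) +
      (2 * W.u₂ * t ^ 8 + 2 * W.u₂ * W.v ^ 2 * t ^ 8 - 2 * W.u₂ ^ 3 * t ^ 8
          - 4 * W.u₁ * W.v * t ^ 6 + 2 * W.u₁ * W.u₂ ^ 2 * W.v * t ^ 6
          + 2 * W.u₁ * W.u₂ ^ 2 * W.v ^ 3 * t ^ 6 - 2 * W.u₁ * W.u₂ ^ 4 * W.v * t ^ 6
          + 2 * W.u₁ ^ 2 * W.u₂ * t ^ 4 - 4 * W.u₁ ^ 2 * W.u₂ * W.v ^ 2 * t ^ 4
          + 2 * W.u₁ ^ 2 * W.u₂ * W.v ^ 2 * W.w₁ * t ^ 8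
          - 2 * W.u₁ ^ 2 * W.u₂ * W.v ^ 4 * t ^ 4 - 2 * W.u₁ ^ 2 * W.u₂ ^ 3 * W.w₁ * t ^ 8
          + 2 * W.u₁ ^ 2 * W.u₂ ^ 3 * W.v ^ 2 * t ^ 4 + 2 * W.u₁ ^ 3 * W.u₂ ^ 2 * W.v * t ^ 2
          - 2 * W.u₁ ^ 3 * W.u₂ ^ 2 * W.v * t ^ 6
          + 2 * W.u₁ ^ 4 * W.u₂ * W.v ^ 2 * t ^ 4) * (eLS + eRN) + (-2 * W.u₂ * t ^ 7
          - 2 * W.u₂ * W.v ^ 2 * t ^ 7 + 2 * W.u₂ ^ 3 * t ^ 7 + 4 * W.u₁ * W.v * t ^ 5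
          - 2 * W.u₁ ^ 2 * W.u₂ * t ^ 3) * (b3 + b4)
  have kt2 : 2 * W.u₁ ^ 2 * W.u₂ * t ^ 2 * dominoDetS2 W t * (c 2 + c 4) = 0 := by
    rw [dominoDetS2]
    linear_combination (-2 * W.u₁ ^ 2 * W.u₂ ^ 2 * W.v * W.w₁ * t ^ 9
        + 2 * W.u₁ ^ 2 * W.u₂ ^ 2 * W.v ^ 3 * t ^ 5 - 2 * W.u₁ ^ 2 * W.u₂ ^ 4 * W.v * t ^ 5
        + 2 * W.u₁ ^ 3 * W.u₂ * W.w₁ * t ^ 7 - 2 * W.u₁ ^ 3 * W.u₂ * W.v ^ 2 * t ^ 3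
        + 2 * W.u₁ ^ 3 * W.u₂ ^ 3 * t ^ 11 + 2 * W.u₁ ^ 4 * W.u₂ ^ 2 * W.v * t
        - 2 * W.u₁ ^ 5 * W.u₂ * t ^ 7) * (eLW + eRE)
        + (2 * W.u₁ ^ 2 * W.u₂ * W.v ^ 2 * W.w₁ * t ^ 8 - 2 * W.u₁ ^ 2 * W.u₂ * W.v ^ 4 * t ^ 4
        + 2 * W.u₁ ^ 2 * W.u₂ ^ 3 * W.v ^ 2 * t ^ 4 - 2 * W.u₁ ^ 3 * W.u₂ ^ 2 * W.v * t ^ 2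
        - 2 * W.u₁ ^ 3 * W.u₂ ^ 2 * W.v * t ^ 10 + 2 * W.u₁ ^ 4 * W.u₂ * t ^ 8
        - 2 * W.u₁ ^ 4 * W.u₂ * W.w₁ * t ^ 8 + 2 * W.u₁ ^ 4 * W.u₂ * W.v ^ 2 * t ^ 4) * (eLN
        + eRS) +
      (-4 * W.u₂ * W.v * t ^ 8 + 2 * W.u₁ * t ^ 6 + 2 * W.u₁ * W.v ^ 2 * t ^ 6
          + 2 * W.u₁ * W.u₂ ^ 2 * t ^ 10 - 4 * W.u₁ * W.u₂ ^ 2 * W.v ^ 2 * t ^ 6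
          + 2 * W.u₁ ^ 2 * W.u₂ * W.v * t ^ 4 - 2 * W.u₁ ^ 2 * W.u₂ * W.v * W.w₁ * t ^ 8
          + 4 * W.u₁ ^ 2 * W.u₂ * W.v ^ 3 * t ^ 4 + 2 * W.u₁ ^ 2 * W.u₂ ^ 3 * W.v * t ^ 4
          + 2 * W.u₁ ^ 2 * W.u₂ ^ 3 * W.v * t ^ 8 - 2 * W.u₁ ^ 3 * t ^ 6
          - 2 * W.u₁ ^ 3 * W.u₂ ^ 2 * t ^ 10 + 2 * W.u₁ ^ 3 * W.u₂ ^ 2 * W.w₁ * t ^ 10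
          - 2 * W.u₁ ^ 3 * W.u₂ ^ 2 * W.v ^ 2 * t ^ 2
          - 2 * W.u₁ ^ 3 * W.u₂ ^ 2 * W.v ^ 2 * t ^ 6 - 2 * W.u₁ ^ 4 * W.u₂ * W.v * t ^ 4
          + 2 * W.u₁ ^ 4 * W.u₂ * W.v * t ^ 8) * (eLS + eRN) + (4 * W.u₂ * W.v * t ^ 7
          - 2 * W.u₁ * t ^ 5 - 2 * W.u₁ * W.v ^ 2 * t ^ 5 - 2 * W.u₁ * W.u₂ ^ 2 * t ^ 9
          + 2 * W.u₁ ^ 3 * t ^ 5) * (b3 + b4)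
  have kt3 : 2 * W.u₁ ^ 2 * W.u₂ * t ^ 2 * dominoDetS2 W t * (c 3) = 0 := by
    rw [dominoDetS2]
    linear_combination (-(W.u₁ ^ 2 * W.u₂ * W.w₁ * t ^ 8) + W.u₁ ^ 2 * W.u₂ * W.v ^ 2 * t ^ 4
        + W.u₁ ^ 2 * W.u₂ * W.v ^ 2 * W.w₁ * t ^ 8 - (W.u₁ ^ 2 * W.u₂ * W.v ^ 4 * t ^ 4)
        - (W.u₁ ^ 2 * W.u₂ ^ 3 * W.w₁ * t ^ 8) + W.u₁ ^ 2 * W.u₂ ^ 3 * W.v ^ 2 * t ^ 4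
        - (W.u₁ ^ 3 * W.u₂ ^ 2 * W.v * t ^ 2) - (W.u₁ ^ 3 * W.u₂ ^ 2 * W.v * t ^ 6)
        + W.u₁ ^ 3 * W.u₂ ^ 2 * W.v * W.w₁ * t ^ 6 + W.u₁ ^ 3 * W.u₂ ^ 2 * W.v * W.w₁ * t ^ 10
        + W.u₁ ^ 4 * W.u₂ * t ^ 8 - (W.u₁ ^ 4 * W.u₂ * W.w₁ * t ^ 8)
        + W.u₁ ^ 4 * W.u₂ * W.v ^ 2 * t ^ 4 - (W.u₁ ^ 4 * W.u₂ * W.v ^ 2 * t ^ 8)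
        - (W.u₁ ^ 4 * W.u₂ ^ 3 * t ^ 12) + W.u₁ ^ 6 * W.u₂ * t ^ 8) * (eLW + eRE)
        + (W.u₁ ^ 2 * W.u₂ ^ 2 * W.v * t ^ 3 + W.u₁ ^ 2 * W.u₂ ^ 2 * W.v ^ 3 * t ^ 3
        - (W.u₁ ^ 2 * W.u₂ ^ 4 * W.v * t ^ 3) - (W.u₁ ^ 3 * W.u₂ * t ^ 9)
        + W.u₁ ^ 3 * W.u₂ * W.w₁ * t ^ 9 - 2 * W.u₁ ^ 3 * W.u₂ * W.v ^ 2 * t ^ 5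
        - (W.u₁ ^ 3 * W.u₂ * W.v ^ 2 * t ^ 9) - (W.u₁ ^ 3 * W.u₂ * W.v ^ 2 * W.w₁ * t ^ 9)
        + W.u₁ ^ 3 * W.u₂ ^ 3 * t ^ 9 - (W.u₁ ^ 3 * W.u₂ ^ 3 * W.w₁ * t ^ 5)
        + 2 * W.u₁ ^ 4 * W.u₂ ^ 2 * W.v * t ^ 7 + W.u₁ ^ 4 * W.u₂ ^ 2 * W.v * t ^ 11
        - (W.u₁ ^ 5 * W.u₂ * t ^ 9) + W.u₁ ^ 5 * W.u₂ * W.w₁ * t ^ 9) * (eLN + eRS) +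
      (-(t ^ 7) + W.v ^ 4 * t ^ 7 - 2 * W.u₂ ^ 2 * W.v ^ 2 * t ^ 7 + W.u₂ ^ 4 * t ^ 7
          + W.u₁ * W.u₂ * W.v * t ^ 5 + 2 * W.u₁ * W.u₂ * W.v * t ^ 9
          + W.u₁ * W.u₂ * W.v ^ 5 * t ^ 5 - 2 * W.u₁ * W.u₂ ^ 3 * W.v ^ 3 * t ^ 5
          + W.u₁ * W.u₂ ^ 5 * W.v * t ^ 5 - 2 * W.u₁ ^ 2 * W.v ^ 2 * t ^ 7
          - (W.u₁ ^ 2 * W.u₂ ^ 2 * t ^ 3) - (W.u₁ ^ 2 * W.u₂ ^ 2 * t ^ 11)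
          + W.u₁ ^ 2 * W.u₂ ^ 2 * W.w₁ * t ^ 7 + 2 * W.u₁ ^ 2 * W.u₂ ^ 2 * W.v ^ 2 * t ^ 7
          - (W.u₁ ^ 2 * W.u₂ ^ 2 * W.v ^ 2 * W.w₁ * t ^ 7) + W.u₁ ^ 2 * W.u₂ ^ 4 * W.w₁ * t ^ 7
          + W.u₁ ^ 3 * W.u₂ * W.v * t ^ 5 + W.u₁ ^ 3 * W.u₂ * W.v * t ^ 9
          - (W.u₁ ^ 3 * W.u₂ * W.v ^ 3 * t ^ 5) + W.u₁ ^ 3 * W.u₂ * W.v ^ 3 * t ^ 9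
          - 2 * W.u₁ ^ 3 * W.u₂ ^ 3 * W.v * t ^ 9 + W.u₁ ^ 4 * t ^ 7
          - (W.u₁ ^ 4 * W.u₂ ^ 2 * t ^ 7) + W.u₁ ^ 4 * W.u₂ ^ 2 * t ^ 11
          - (W.u₁ ^ 4 * W.u₂ ^ 2 * W.w₁ * t ^ 11) - (W.u₁ ^ 5 * W.u₂ * W.v * t ^ 9)) * (eLS
          + eRN) + (t ^ 6 - (W.v ^ 4 * t ^ 6) + 2 * W.u₂ ^ 2 * W.v ^ 2 * t ^ 6
          - (W.u₂ ^ 4 * t ^ 6) - 2 * W.u₁ * W.u₂ * W.v * t ^ 4 - 2 * W.u₁ * W.u₂ * W.v * t ^ 8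
          + 2 * W.u₁ ^ 2 * W.v ^ 2 * t ^ 6 + W.u₁ ^ 2 * W.u₂ ^ 2 * t ^ 2
          + W.u₁ ^ 2 * W.u₂ ^ 2 * t ^ 10 - (W.u₁ ^ 4 * t ^ 6)) * (b3 + b4)
  have ku0 : 2 * W.u₁ * W.u₂ ^ 2 * t ^ 6 * dominoDetS3 W t * (c 0 + c 6) = 0 := by
    rw [dominoDetS3]
    linear_combination (2 * W.u₁ * W.u₂ ^ 4 * W.v * t ^ 6 + 2 * W.u₁ * W.u₂ ^ 4 * W.v * t ^ 10
        - 2 * W.u₁ ^ 2 * W.u₂ ^ 3 * t ^ 4 - 2 * W.u₁ ^ 2 * W.u₂ ^ 3 * W.v ^ 2 * t ^ 8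
        - 2 * W.u₁ ^ 2 * W.u₂ ^ 3 * W.v ^ 2 * t ^ 12
        + 2 * W.u₁ ^ 3 * W.u₂ ^ 2 * W.v * t ^ 10) * (eLW + eRE) + (2 * W.v * t ^ 7
        - 2 * W.v ^ 3 * t ^ 7 + 2 * W.u₂ ^ 2 * W.v * t ^ 7 - 2 * W.u₁ * W.u₂ * t ^ 5
        - 2 * W.u₁ * W.u₂ * t ^ 9 + 2 * W.u₁ * W.u₂ * W.v ^ 2 * t ^ 9
        - 2 * W.u₁ * W.u₂ * W.v ^ 4 * t ^ 9 - 2 * W.u₁ * W.u₂ ^ 3 * W.v ^ 2 * t ^ 5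
        + 2 * W.u₁ ^ 2 * W.v * t ^ 7 - 2 * W.u₁ ^ 2 * W.u₂ ^ 2 * W.v * t ^ 7
        - 2 * W.u₁ ^ 2 * W.u₂ ^ 2 * W.v * t ^ 11 + 2 * W.u₁ ^ 2 * W.u₂ ^ 2 * W.v ^ 3 * t ^ 11
        + 2 * W.u₁ ^ 2 * W.u₂ ^ 4 * W.v * t ^ 7 + 2 * W.u₁ ^ 3 * W.u₂ * W.v ^ 2 * t ^ 9
        + 2 * W.u₁ ^ 3 * W.u₂ ^ 3 * t ^ 5 - 2 * W.u₁ ^ 4 * W.u₂ ^ 2 * W.v * t ^ 11) * (eLN + eRS) +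
      (2 * W.u₁ * W.u₂ ^ 3 * W.v * t ^ 5 + 2 * W.u₁ * W.u₂ ^ 3 * W.v ^ 3 * t ^ 9
          - 2 * W.u₁ * W.u₂ ^ 5 * W.v * t ^ 9 - 2 * W.u₁ ^ 2 * W.u₂ ^ 2 * W.v ^ 2 * t ^ 11
          - 2 * W.u₁ ^ 2 * W.u₂ ^ 4 * t ^ 7 + 2 * W.u₁ ^ 3 * W.u₂ ^ 3 * W.v * t ^ 13) * (eLS
          + eRN) + (-2 * W.v * t ^ 6 + 2 * W.v ^ 3 * t ^ 6 - 2 * W.u₂ ^ 2 * W.v * t ^ 6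
          + 2 * W.u₁ * W.u₂ * t ^ 4 + 2 * W.u₁ * W.u₂ * t ^ 8
          - 2 * W.u₁ ^ 2 * W.v * t ^ 6) * (b5 + b6)
  have ku1 : 2 * W.u₁ * W.u₂ ^ 2 * t ^ 6 * dominoDetS3 W t * (c 1 + c 5) = 0 := by
    rw [dominoDetS3]
    linear_combination (2 * W.u₁ * W.u₂ ^ 3 * W.w₂ * t ^ 7
        - 2 * W.u₁ * W.u₂ ^ 3 * W.v ^ 2 * t ^ 11 - 2 * W.u₁ * W.u₂ ^ 5 * t ^ 7
        - 2 * W.u₁ ^ 2 * W.u₂ ^ 2 * W.v * W.w₂ * t ^ 5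
        + 2 * W.u₁ ^ 2 * W.u₂ ^ 2 * W.v ^ 3 * t ^ 9 + 2 * W.u₁ ^ 2 * W.u₂ ^ 4 * W.v * t ^ 13
        + 2 * W.u₁ ^ 3 * W.u₂ ^ 3 * t ^ 3 - 2 * W.u₁ ^ 4 * W.u₂ ^ 2 * W.v * t ^ 9) * (eLW
        + eRE) + (2 * W.u₂ * t ^ 8 + 2 * W.u₂ * W.v ^ 2 * t ^ 8 - 2 * W.u₂ ^ 3 * t ^ 8
        - 4 * W.u₁ * W.v * t ^ 6 + 2 * W.u₁ * W.u₂ ^ 2 * W.v * t ^ 10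
        - 2 * W.u₁ * W.u₂ ^ 2 * W.v * W.w₂ * t ^ 6 + 4 * W.u₁ * W.u₂ ^ 2 * W.v ^ 3 * t ^ 10
        + 2 * W.u₁ * W.u₂ ^ 4 * W.v * t ^ 6 - 2 * W.u₁ * W.u₂ ^ 4 * W.v * t ^ 10
        + 2 * W.u₁ ^ 2 * W.u₂ * t ^ 4 - 4 * W.u₁ ^ 2 * W.u₂ * W.v ^ 2 * t ^ 8
        - 2 * W.u₁ ^ 2 * W.u₂ ^ 3 * t ^ 4 + 2 * W.u₁ ^ 2 * W.u₂ ^ 3 * W.w₂ * t ^ 4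
        - 2 * W.u₁ ^ 2 * W.u₂ ^ 3 * W.v ^ 2 * t ^ 8
        - 2 * W.u₁ ^ 2 * W.u₂ ^ 3 * W.v ^ 2 * t ^ 12 + 2 * W.u₁ ^ 3 * W.u₂ ^ 2 * W.v * t ^ 6
        + 2 * W.u₁ ^ 3 * W.u₂ ^ 2 * W.v * t ^ 10) * (eLN + eRS) +
      (2 * W.u₁ * W.u₂ ^ 2 * W.v ^ 2 * W.w₂ * t ^ 6 - 2 * W.u₁ * W.u₂ ^ 2 * W.v ^ 4 * t ^ 10
          + 2 * W.u₁ * W.u₂ ^ 4 * t ^ 6 - 2 * W.u₁ * W.u₂ ^ 4 * W.w₂ * t ^ 6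
          + 2 * W.u₁ * W.u₂ ^ 4 * W.v ^ 2 * t ^ 10 - 2 * W.u₁ ^ 2 * W.u₂ ^ 3 * W.v * t ^ 4
          - 2 * W.u₁ ^ 2 * W.u₂ ^ 3 * W.v * t ^ 12
          + 2 * W.u₁ ^ 3 * W.u₂ ^ 2 * W.v ^ 2 * t ^ 10) * (eLS + eRN) + (-2 * W.u₂ * t ^ 7
          - 2 * W.u₂ * W.v ^ 2 * t ^ 7 + 2 * W.u₂ ^ 3 * t ^ 7 + 4 * W.u₁ * W.v * t ^ 5
          - 2 * W.u₁ ^ 2 * W.u₂ * t ^ 3) * (b5 + b6)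
  have ku2 : 2 * W.u₁ * W.u₂ ^ 2 * t ^ 6 * dominoDetS3 W t * (c 2 + c 4) = 0 := by
    rw [dominoDetS3]
    linear_combination (-2 * W.u₁ * W.u₂ ^ 3 * W.v * W.w₂ * t ^ 7
        + 2 * W.u₁ * W.u₂ ^ 3 * W.v ^ 3 * t ^ 11 - 2 * W.u₁ * W.u₂ ^ 5 * W.v * t ^ 11
        + 2 * W.u₁ ^ 2 * W.u₂ ^ 2 * W.w₂ * t ^ 5 - 2 * W.u₁ ^ 2 * W.u₂ ^ 2 * W.v ^ 2 * t ^ 9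
        + 2 * W.u₁ ^ 3 * W.u₂ ^ 3 * W.v * t ^ 7) * (eLW + eRE) + (-4 * W.u₂ * W.v * t ^ 8
        + 2 * W.u₁ * t ^ 6 + 2 * W.u₁ * W.v ^ 2 * t ^ 6 + 2 * W.u₁ * W.u₂ ^ 2 * t ^ 10
        - 4 * W.u₁ * W.u₂ ^ 2 * W.v ^ 2 * t ^ 10 + 2 * W.u₁ * W.u₂ ^ 2 * W.v ^ 2 * W.w₂ * t ^ 6
        - 2 * W.u₁ * W.u₂ ^ 2 * W.v ^ 4 * t ^ 10 + 2 * W.u₁ * W.u₂ ^ 4 * W.v ^ 2 * t ^ 10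
        + 2 * W.u₁ ^ 2 * W.u₂ * W.v * t ^ 8 + 2 * W.u₁ ^ 2 * W.u₂ * W.v ^ 3 * t ^ 8
        - 2 * W.u₁ ^ 2 * W.u₂ ^ 3 * W.v * t ^ 8 + 2 * W.u₁ ^ 2 * W.u₂ ^ 3 * W.v * t ^ 12
        - 2 * W.u₁ ^ 3 * t ^ 6 - 2 * W.u₁ ^ 3 * W.u₂ ^ 2 * W.w₂ * t ^ 6
        + 2 * W.u₁ ^ 3 * W.u₂ ^ 2 * W.v ^ 2 * t ^ 10
        - 2 * W.u₁ ^ 4 * W.u₂ * W.v * t ^ 8) * (eLN + eRS) +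
      (-2 * W.u₁ * W.u₂ ^ 2 * W.v * W.w₂ * t ^ 6 + 2 * W.u₁ * W.u₂ ^ 2 * W.v ^ 3 * t ^ 10
          + 2 * W.u₁ * W.u₂ ^ 4 * W.v * t ^ 10 + 2 * W.u₁ ^ 2 * W.u₂ ^ 3 * W.w₂ * t ^ 8
          - 2 * W.u₁ ^ 2 * W.u₂ ^ 3 * W.v ^ 2 * t ^ 8
          - 2 * W.u₁ ^ 2 * W.u₂ ^ 3 * W.v ^ 2 * t ^ 12) * (eLS + eRN) + (4 * W.u₂ * W.v * t ^ 7
          - 2 * W.u₁ * t ^ 5 - 2 * W.u₁ * W.v ^ 2 * t ^ 5 - 2 * W.u₁ * W.u₂ ^ 2 * t ^ 9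
          + 2 * W.u₁ ^ 3 * t ^ 5) * (b5 + b6)
  have ku3 : 2 * W.u₁ * W.u₂ ^ 2 * t ^ 6 * dominoDetS3 W t * (c 3) = 0 := by
    rw [dominoDetS3]
    linear_combination (-(W.u₁ * W.u₂ ^ 2 * W.w₂ * t ^ 6) + W.u₁ * W.u₂ ^ 2 * W.v ^ 2 * t ^ 10
        + W.u₁ * W.u₂ ^ 2 * W.v ^ 2 * W.w₂ * t ^ 6 - (W.u₁ * W.u₂ ^ 2 * W.v ^ 4 * t ^ 10)
        + W.u₁ * W.u₂ ^ 4 * t ^ 6 - (W.u₁ * W.u₂ ^ 4 * W.w₂ * t ^ 6)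
        - (W.u₁ * W.u₂ ^ 4 * W.v ^ 2 * t ^ 6) + W.u₁ * W.u₂ ^ 4 * W.v ^ 2 * t ^ 10
        + W.u₁ * W.u₂ ^ 6 * t ^ 6 - (W.u₁ ^ 2 * W.u₂ ^ 3 * W.v * t ^ 8)
        - (W.u₁ ^ 2 * W.u₂ ^ 3 * W.v * t ^ 12) + W.u₁ ^ 2 * W.u₂ ^ 3 * W.v * W.w₂ * t ^ 4
        + W.u₁ ^ 2 * W.u₂ ^ 3 * W.v * W.w₂ * t ^ 8 - (W.u₁ ^ 3 * W.u₂ ^ 2 * W.w₂ * t ^ 6)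
        + W.u₁ ^ 3 * W.u₂ ^ 2 * W.v ^ 2 * t ^ 10 - (W.u₁ ^ 3 * W.u₂ ^ 4 * t ^ 2)) * (eLW + eRE)
        + (-(t ^ 7) + W.v ^ 4 * t ^ 7 - 2 * W.u₂ ^ 2 * W.v ^ 2 * t ^ 7 + W.u₂ ^ 4 * t ^ 7
        + 2 * W.u₁ * W.u₂ * W.v * t ^ 5 + W.u₁ * W.u₂ * W.v * t ^ 9
        + W.u₁ * W.u₂ * W.v ^ 5 * t ^ 9 + W.u₁ * W.u₂ ^ 3 * W.v * t ^ 5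
        + W.u₁ * W.u₂ ^ 3 * W.v * t ^ 9 + W.u₁ * W.u₂ ^ 3 * W.v ^ 3 * t ^ 5
        - (W.u₁ * W.u₂ ^ 3 * W.v ^ 3 * t ^ 9) - (W.u₁ * W.u₂ ^ 5 * W.v * t ^ 5)
        - 2 * W.u₁ ^ 2 * W.v ^ 2 * t ^ 7 - (W.u₁ ^ 2 * W.u₂ ^ 2 * t ^ 3)
        - (W.u₁ ^ 2 * W.u₂ ^ 2 * t ^ 11) + W.u₁ ^ 2 * W.u₂ ^ 2 * W.w₂ * t ^ 7
        + 2 * W.u₁ ^ 2 * W.u₂ ^ 2 * W.v ^ 2 * t ^ 7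
        - (W.u₁ ^ 2 * W.u₂ ^ 2 * W.v ^ 2 * W.w₂ * t ^ 7) + W.u₁ ^ 2 * W.u₂ ^ 4 * t ^ 3
        - (W.u₁ ^ 2 * W.u₂ ^ 4 * t ^ 7) - (W.u₁ ^ 2 * W.u₂ ^ 4 * W.w₂ * t ^ 3)
        - 2 * W.u₁ ^ 3 * W.u₂ * W.v ^ 3 * t ^ 9 - 2 * W.u₁ ^ 3 * W.u₂ ^ 3 * W.v * t ^ 5
        + W.u₁ ^ 4 * t ^ 7 + W.u₁ ^ 4 * W.u₂ ^ 2 * W.w₂ * t ^ 7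
        + W.u₁ ^ 5 * W.u₂ * W.v * t ^ 9) * (eLN + eRS) +
      (-(W.u₁ * W.u₂ ^ 3 * t ^ 5) + W.u₁ * W.u₂ ^ 3 * W.w₂ * t ^ 5
          - (W.u₁ * W.u₂ ^ 3 * W.v ^ 2 * t ^ 5) - 2 * W.u₁ * W.u₂ ^ 3 * W.v ^ 2 * t ^ 9
          - (W.u₁ * W.u₂ ^ 3 * W.v ^ 2 * W.w₂ * t ^ 5) - (W.u₁ * W.u₂ ^ 5 * t ^ 5)
          + W.u₁ * W.u₂ ^ 5 * W.w₂ * t ^ 5 + W.u₁ ^ 2 * W.u₂ ^ 2 * W.v * t ^ 11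
          + W.u₁ ^ 2 * W.u₂ ^ 2 * W.v ^ 3 * t ^ 11 + W.u₁ ^ 2 * W.u₂ ^ 4 * W.v * t ^ 3
          + 2 * W.u₁ ^ 2 * W.u₂ ^ 4 * W.v * t ^ 7 + W.u₁ ^ 3 * W.u₂ ^ 3 * t ^ 5
          - (W.u₁ ^ 3 * W.u₂ ^ 3 * W.w₂ * t ^ 9) - (W.u₁ ^ 4 * W.u₂ ^ 2 * W.v * t ^ 11)) * (eLS
          + eRN) + (t ^ 6 - (W.v ^ 4 * t ^ 6) + 2 * W.u₂ ^ 2 * W.v ^ 2 * t ^ 6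
          - (W.u₂ ^ 4 * t ^ 6) - 2 * W.u₁ * W.u₂ * W.v * t ^ 4 - 2 * W.u₁ * W.u₂ * W.v * t ^ 8
          + 2 * W.u₁ ^ 2 * W.v ^ 2 * t ^ 6 + W.u₁ ^ 2 * W.u₂ ^ 2 * t ^ 2
          + W.u₁ ^ 2 * W.u₂ ^ 2 * t ^ 10 - (W.u₁ ^ 4 * t ^ 6)) * (b5 + b6)
  have hu : W.u₁ ^ 2 * W.u₂ ≠ 0 := mul_ne_zero (pow_ne_zero 2 h1) h2
  have hv : W.u₁ * W.u₂ ^ 2 ≠ 0 := mul_ne_zero h1 (pow_ne_zero 2 h2)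
  -- antisymmetric part
  have a0 : c 0 - c 6 = 0 := by
    rcases hA with hA | hA | hA
    · exact (mul_eq_zero.1 ka0).resolve_left (mul_ne_zero (pow_ne_zero 2 ht) hA)
    · exact (mul_eq_zero.1 kb0).resolve_left (mul_ne_zero (mul_ne_zero hu (pow_ne_zero 3 ht)) hA)
    · exact (mul_eq_zero.1 kc0).resolve_left (mul_ne_zero (mul_ne_zero hv (pow_ne_zero 3 ht)) hA)
  have a1 : c 1 - c 5 = 0 := by
    rcases hA with hA | hA | hA
    · exact (mul_eq_zero.1 ka1).resolve_left (mul_ne_zero (pow_ne_zero 2 ht) hA)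
    · exact (mul_eq_zero.1 kb1).resolve_left (mul_ne_zero (mul_ne_zero hu (pow_ne_zero 3 ht)) hA)
    · exact (mul_eq_zero.1 kc1).resolve_left (mul_ne_zero (mul_ne_zero hv (pow_ne_zero 3 ht)) hA)
  have a2 : c 2 - c 4 = 0 := by
    rcases hA with hA | hA | hA
    · exact (mul_eq_zero.1 ka2).resolve_left (mul_ne_zero (pow_ne_zero 2 ht) hA)
    · exact (mul_eq_zero.1 kb2).resolve_left (mul_ne_zero (mul_ne_zero hu (pow_ne_zero 3 ht)) hA)
    · exact (mul_eq_zero.1 kc2).resolve_left (mul_ne_zero (mul_ne_zero hv (pow_ne_zero 3 ht)) hA)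
  -- symmetric part
  have hu2 : 2 * W.u₁ ^ 2 * W.u₂ ≠ 0 := mul_ne_zero (mul_ne_zero two_ne_zero (pow_ne_zero 2 h1)) h2
  have hv2 : 2 * W.u₁ * W.u₂ ^ 2 ≠ 0 := mul_ne_zero (mul_ne_zero two_ne_zero h1) (pow_ne_zero 2 h2)
  have s0 : c 0 + c 6 = 0 := by
    rcases hS with hS | hS | hS
    · exact (mul_eq_zero.1 ks0).resolve_left (mul_ne_zero (mul_ne_zero hu2 (pow_ne_zero 3 ht)) hS)
    · exact (mul_eq_zero.1 kt0).resolve_left (mul_ne_zero (mul_ne_zero hu2 (pow_ne_zero 2 ht)) hS)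
    · exact (mul_eq_zero.1 ku0).resolve_left (mul_ne_zero (mul_ne_zero hv2 (pow_ne_zero 6 ht)) hS)
  have s1 : c 1 + c 5 = 0 := by
    rcases hS with hS | hS | hS
    · exact (mul_eq_zero.1 ks1).resolve_left (mul_ne_zero (mul_ne_zero hu2 (pow_ne_zero 3 ht)) hS)
    · exact (mul_eq_zero.1 kt1).resolve_left (mul_ne_zero (mul_ne_zero hu2 (pow_ne_zero 2 ht)) hS)
    · exact (mul_eq_zero.1 ku1).resolve_left (mul_ne_zero (mul_ne_zero hv2 (pow_ne_zero 6 ht)) hS)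
  have s2 : c 2 + c 4 = 0 := by
    rcases hS with hS | hS | hS
    · exact (mul_eq_zero.1 ks2).resolve_left (mul_ne_zero (mul_ne_zero hu2 (pow_ne_zero 3 ht)) hS)
    · exact (mul_eq_zero.1 kt2).resolve_left (mul_ne_zero (mul_ne_zero hu2 (pow_ne_zero 2 ht)) hS)
    · exact (mul_eq_zero.1 ku2).resolve_left (mul_ne_zero (mul_ne_zero hv2 (pow_ne_zero 6 ht)) hS)
  have s3 : c 3 = 0 := by
    rcases hS with hS | hS | hS
    · exact (mul_eq_zero.1 ks3).resolve_left (mul_ne_zero (mul_ne_zero hu2 (pow_ne_zero 3 ht)) hS)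
    · exact (mul_eq_zero.1 kt3).resolve_left (mul_ne_zero (mul_ne_zero hu2 (pow_ne_zero 2 ht)) hS)
    · exact (mul_eq_zero.1 ku3).resolve_left (mul_ne_zero (mul_ne_zero hv2 (pow_ne_zero 6 ht)) hS)
  funext i
  fin_cases i
  · show c 0 = 0
    linear_combination (s0 + a0) / 2
  · show c 1 = 0
    linear_combination (s1 + a1) / 2
  · show c 2 = 0
    linear_combination (s2 + a2) / 2
  · show c 3 = 0
    exact s3
  · show c 4 = 0
    linear_combination (s2 - a2) / 2
  · show c 5 = 0
    linear_combination (s1 - a1) / 2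
  · show c 6 = 0
    linear_combination (s0 - a0) / 2

/-- ★★ Contrapositive: a nonzero two-plaquette identity with `u₁u₂ ≠ 0` lies on
`{dominoDetA = dominoDetA2 = dominoDetA3 = 0} ∪ {dominoDetS = dominoDetS2 = dominoDetS3 = 0}`. [cite: Glazman2015WeightedSAW, Lemma 3.1 (proof: "solving this linear system")] -/
theorem dominoDet_pair_eq_zero_of_exists (ht : t ≠ 0) (h1 : W.u₁ ≠ 0) (h2 : W.u₂ ≠ 0)
    (h : ∃ c : Fin 7 → ℂ, c ≠ 0 ∧ ExactDominoVertexRelation W t c) :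
    (dominoDetA W t = 0 ∧ dominoDetA2 W t = 0 ∧ dominoDetA3 W t = 0) ∨
      (dominoDetS W t = 0 ∧ dominoDetS2 W t = 0 ∧ dominoDetS3 W t = 0) := by
  obtain ⟨c, hc, hrel⟩ := h
  by_contra hne
  simp only [not_or, not_and_or] at hne
  obtain ⟨hA, hS⟩ := hne
  have hA' : dominoDetA W t ≠ 0 ∨ dominoDetA2 W t ≠ 0 ∨ dominoDetA3 W t ≠ 0 := by tauto
  have hS' : dominoDetS W t ≠ 0 ∨ dominoDetS2 W t ≠ 0 ∨ dominoDetS3 W t ≠ 0 := by tauto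
  exact hc (eq_zero_of_exactDominoVertexRelation_sharp ht h1 h2 hA' hS' hrel)

/-- **Barrier `PlaquetteWalkDominoGenericTrivialitySharp`** (named statement): for the five-weight plaquette
walk on `ℤ²` with `u₁u₂ ≠ 0`, `t ≠ 0`, every nonzero exact two-plaquette (domino) vertex relation lies on
`{dominoDetA = dominoDetA2 = dominoDetA3 = 0} ∪ {dominoDetS = dominoDetS2 = dominoDetS3 = 0}`. A THEOREM of this file
(`PlaquetteWalkDominoGenericTrivialitySharp_holds`).

BARRIER (structured block, D-0021):
- technique_class: two-plaquette (domino) constant-coefficient vertex relations `ExactDominoVertexRelation W t c` of the GM plaquette walk on `ℤ²`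
- blocks: every nonzero domino identity with `u₁u₂ ≠ 0` off the algebraic set `{dominoDetA = dominoDetA2 = dominoDetA3 = 0} ∪ {dominoDetS = dominoDetS2 = dominoDetS3 = 0}` (all six polynomials explicit: 13, 14, 14, 21, 23, 23 terms; an explicit algebraic set of codimension TWO — it contains the four families `{v = ±1, u₂ = ±t²u₁}` (A-branch) / `{v = ±1, u₁ = ±t²u₂}` (S-branch) with `w₁, w₂` free and one further family per branch over `Q(u₁,v,t) = (1+t⁴)²u₁²(u₁²−v²−1) + 4t⁴v² = 0` (lane exact algebra, lit-2 g21), as well as Glazman's degenerate family)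
- because: the six cleared rows and three `2 × 2`-block instances with their half-turn images (roots `W`, `S` of the lower-left and `S` of the lower-right plaquette), antisymmetrised / symmetrised under the half-turn; six adjugate certificates checked by `ring`
- evasions_known: weight systems on the exceptional set (it contains the sixteen Yang–Baxter curves and Glazman's lines, where plaquette translates live); root-dependent coefficients; larger stencils
- scope_caveats: a necessary condition for a nonzero identity only, not claimed sharp — the exceptional set is not small: whole 4-parameter families (`w₁, w₂` free) lie in it, and it contains certificate-degenerate points carrying NO identity (lane probe, not typed: for the uniform walk at `(x, t) = (1/3, 1)` the rows + `2 × 2`-block system is degenerate with kernel vector `(1,1,1,−6,1,1,1)`, which the `2 × 3` block excludes); horizontal dominoes; `t = 0` excluded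
- status: established — `PlaquetteWalkDominoGenericTrivialitySharp_holds`; print: one-plaquette determinants [cite: Glazman2015WeightedSAW, Lemma 3.1] [cite: IkhlefCardy2009, §3]
[cite: Glazman2015WeightedSAW, Lemma 3.1] -/
def _root_.Literature.Barriers.CriticalPhenomena.PlaquetteWalkDominoGenericTrivialitySharp : Prop :=
  ∀ (W : CWeights) (t : ℂ), t ≠ 0 → W.u₁ ≠ 0 → W.u₂ ≠ 0 →
    (∃ c : Fin 7 → ℂ, c ≠ 0 ∧ ExactDominoVertexRelation W t c) →
      (dominoDetA W t = 0 ∧ dominoDetA2 W t = 0 ∧ dominoDetA3 W t = 0) ∨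
        (dominoDetS W t = 0 ∧ dominoDetS2 W t = 0 ∧ dominoDetS3 W t = 0)

/-- **`PlaquetteWalkDominoGenericTrivialitySharp` holds.** [cite: Glazman2015WeightedSAW, Lemma 3.1] -/
theorem _root_.Literature.Barriers.CriticalPhenomena.PlaquetteWalkDominoGenericTrivialitySharp_holds :
    PlaquetteWalkDominoGenericTrivialitySharp :=
  fun _ _ ht h1 h2 h => dominoDet_pair_eq_zero_of_exists ht h1 h2 h

end Sharp

end PlaquetteWalk

end Literature.Barriers.CriticalPhenomena
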